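import Literature.MathematicalPhysics.QuantumLattice.FermiRG.FST2SecondOrderStrings
import Literature.MathematicalPhysics.QuantumLattice.FermiRG.FST2FermiCurveParam
import Literature.Analysis.ODE.CompactSupportFlow
import Mathlib.Analysis.Calculus.BumpFunction.Convolution
import Mathlib.Analysis.Calculus.BumpFunction.InnerProduct
import Mathlib.Analysis.Calculus.InverseFunctionTheorem.ContDiff
import Mathlib.Analysis.Calculus.Deriv.Inverse
import Mathlib.MeasureTheory.Measure.Haar.InnerProductSpace
import Mathlib.Topology.MetricSpace.Thickening
import HarnessLib

/-!
# Feldman–Salmhofer–Trubowitz II: the tubular coordinates `(ρ, θ)` of §2.2 exist ([I, Lemma 2.1])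

Topic `Literature/MathematicalPhysics/QuantumLattice/FermiRG`. A PROOF COMPANION (theorems only: no
definitions, no named facts) of `FST2SecondOrderStrings.lean` (gate-hubbard-kl wave file F4c), whose §3
records the radial and angular coordinates `(ρ, θ) ↦ p(ρ, θ)`, `e(p(ρ, θ)) = ρ`, of

* [II] J. Feldman, M. Salmhofer, E. Trubowitz, *Perturbation theory around non-nested Fermi surfaces II.
  Regularity of the moving Fermi surface: RPA contributions*, Comm. Pure Appl. Math. **51** (1998)
  1133–1246, arXiv:cond-mat/9701073 (`FeldmanSalmhoferTrubowitz1998`), §2.2 "Radial and angular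
  coordinates", p.8 L35–60 (locators `p.N Lm` = chunk `pNNNN.txt`, line `m`, of the
  `lit read arxiv:cond-mat/9701073` render of the arXiv TeX),

as the DATA structure `TubularCoords cr e k r₀` — "in [II] this object is CONSTRUCTED; here it is a
hypothesis binder of Theorem 3.5" (F4c, §3). [II] takes the construction from

* [I] J. Feldman, M. Salmhofer, E. Trubowitz, *Perturbation theory around non-nested Fermi surfaces I.
  Keeping the Fermi surface fixed*, J. Stat. Phys. **84** (1996) 1209–1336, arXiv:cond-mat/9509006
  (`FeldmanSalmhoferTrubowitz1996`), Lemma 2.1 (render `paper:arxiv-cond-mat_9509006`, statement p.13 L51–112, proof p.13 L118–p.14 L26,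
  remark on `u = ∇e/|∇e|` p.14 L27–33):
  "(i) There is a `C^∞` vector field `u` transversal to `S` … `Ψ(p, t) = γ_p(t)` [the integral curve of
  `u` through `p ∈ S`] is a `C^k`-diffeomorphism. (ii) … `0 < g₀/2 ≤ u₀ ≤ ∇e(q)·u(q)` … (iv) the map
  `χ : p ↦ (ρ, ω)`, `ρ = e(p)`, is a `C^k`-diffeomorphism … because it is the composition of `Ψ` with
  the inverse of `(ω, τ) ↦ (ω, ρ) = (ω, e(Ψ(ω, τ)))` and because `∂ρ/∂τ = (∇e·u)(Ψ(ω,τ)) ≥ u₀`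
  (drhdta) … The choice `u = ∇e/|∇e|` has most of the above properties, but it is only `C^{k-1}` if
  `e` is `C^k`, and then the maps `Ψ` and `χ` are only `C^{k-1}`."

## What is proved

* `exists_tubularCoords_of_gradient_bound` — **the coordinate datum exists, with prescribed angular
  coordinate, on an explicit tube**: (A2)_{k,h} (`k ≥ 2`), `|e|₂ ≤ K`, `|∇e| ≥ g₀ > 0` on `{|e| < 2r}`
  ([I] (ii) "for all `q ∈ U_{2δ}(S)`") and an angular coordinate `Θ` with `C^k` curve give
  `Φ : TubularCoords cr e k r` with `Φ.base = Θ`.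
* `exists_tubularCoords_base_eq` — **the same from the geometric constants of [II]**:
  for a band `e` with (A2)_{k,h}, `k ≥ 2` (periodic `C^k` lift) and geometric constants
  `GeomConstants e K r₀ g₀ wmin` ((gzerinit) `|∇e| ≥ g₀` on `{|e| < r₀}`, `|e|₂ ≤ K`), and for EVERY
  angular coordinate `Θ : FermiCurveParam cr e` whose curve `Θ.γ` is `C^k`, there is
  `Φ : TubularCoords cr e k (r₀/2)` with `Φ.base = Θ` (tube `{|e| < r₀}`, the set on which (gzerinit)
  holds; [II] p.8 L36: "there is an `r₀ > 0` and a `C^k`-diffeomorphism …"). Any dimension: only the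
  `ρ = 0` slice `Θ` is two-dimensional data.
* `nonempty_tubularCoords` — for `finrank ℝ E = 2`, (A2)_{k,h} (`k ≥ 2`), the global half of (A3)
  (`HypA3Global`) and `GeomConstants e K r₀ g₀ wmin`: `Nonempty (TubularCoords cr e k (r₀/2))` (the
  `C^k` angular coordinate is `FST2FermiCurveParam.exists_fermiCurveParam_contDiff`);
  `GeomConstants.of_radius_le` and `exists_geomConstants_and_tubularCoords` record that the radius
  `r₀/2` then carries the geometric constants AND the coordinates — the one-radius datum of [II]
  p.8 L36–44 in the joint hypothesis shape of Theorem 3.5 (`StringsTheorem`).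
* The three steps of [I, Lemma 2.1], as reusable theorems:
  `exists_smooth_transversal_field` ((i)–(ii): a `C^∞`, `Γ#`-periodic, bounded, Lipschitz field `u`
  with `u·∇e ≥ g₀²/2` on `{|e| < r₀}`), `globalFlow_add_const` (the flow `Ψ` of a periodic field
  commutes with lattice translations), `exists_unique_levelTime` / `contDiffAt_leftInverse_of_levelMap`
  ((iv): along each flow line inside the tube, `e` is strictly increasing with slope `≥ u₀` and takes
  every value of `(-r₀, r₀)` exactly once; the time-to-level map is `C^k` jointly, by the inverse
  function theorem applied to `(ω, τ) ↦ (ω, e(Ψ(ω, τ)))`).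

* §6, consequences of ANY datum `Φ : TubularCoords cr e k r₀` (not only the constructed one):
  `TubularCoords.abs_apply_lt` (the strip maps into the tube), `TubularCoords.injOn_uncurry` (joint
  injectivity on `(-2r₀, 2r₀) × [0, 2π)` — the hypothesis of the change-of-variables formula),
  `TubularCoords.inner_gradient_dtheta_eq_zero` / `inner_gradient_drho_eq_one` ((Trick) at general `ρ`:
  `∇e·∂_θ p = 0`, `∇e·∂_ρ p = 1`), `TubularCoords.inner_u_gradient_pos`, `TubularCoords.drho_ne_smul_dtheta`,
  and (Interpol) of [I] (iii): `TubularCoords.exists_norm_sub_base_le` (`‖p(ρ,θ) - p(0,θ)‖ ≤ A|ρ|`);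
  injectivity ON THE TORUS `𝓑 = E/Γ#` (p.8 L36–38 "`ϕ : 𝒜 → ϕ(𝒜) ⊂ 𝓑` is a diffeomorphism"):
  `TubularCoords.apply_eq_add_of_apply_eq_add` (level lines through `Γ#`-translates are translates —
  ODE uniqueness for the periodic field `u/(u·∇e)`) and `TubularCoords.eq_of_apply_eq_add`
  (`p(ρ,θ) - p(ρ',θ') ∈ Γ#` with `θ, θ' ∈ [0,2π)` forces equality), for `e ∈ C²` `Γ#`-periodic
  (`TubularCoords.eq_of_apply_eq_add_of_hypA2`: under (A2)_{k,h}, `k ≥ 2`).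
* §7 (JacobianJ) ([II] p.8 L56–60 "`∫ d²p F(p) = ∫ dρ ∫ dθ J(ρ,θ) F(p(ρ,θ))`, `J = |det p'|`"):
  `Crystal.isAddFundamentalDomain_of_measurableSet` (`F` measurable ⇒ `F` is a
  `MeasureTheory.IsAddFundamentalDomain` for `Γ#`) and `TubularCoords.setLIntegral_tube_eq` — for
  `e ∈ C²` periodic, `k ≥ 1`, `F` measurable, an orthonormal frame `b` of `E ≅ ℝ²`, `ε ≤ 2r₀` and ANY
  `Γ#`-periodic `G : E → [0,∞]`:
  `∫⁻_{q ∈ F, |e q| < ε} G = ∫⁻_{(-ε,ε)×[0,2π)} |det(Dp(ρ,θ) ∘ π_b)| G(p(ρ,θ))`, `π_b = (⟪b₀,·⟫, ⟪b₁,·⟫)`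
  (fundamental-domain rearrangement `IsAddFundamentalDomain.setLIntegral_eq_tsum'` + exact tiling of
  the tube by the translates of `p((-ε,ε)×[0,2π))` + Mathlib's area formula
  `lintegral_image_eq_lintegral_abs_det_fderiv_mul` + the measure-preserving frame);
  `TubularCoords.setLIntegral_tube_eq_of_hypA2` (the same under (A2)_{k,h}, `k ≥ 2`), and the bound
  used throughout [II] §3, `TubularCoords.exists_setLIntegral_tube_le`: `∃ J₀ ≥ 0`, for `ε ≤ r₀` and
  periodic `G`, `∫⁻_{q ∈ F, |e q| < ε} G ≤ J₀ ∫⁻_{(-ε,ε)×[0,2π)} G(p(ρ,θ))` ([I] L2.1 (iv) `sup|J| < ∞`).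

## Proof (follows [I, Lemma 2.1]; deviations named)

(i) [I] builds the `C^∞` transversal field from a partition of unity subordinate to a finite cover
of `S` by balls on which the unit normal varies little (p.13 L118–145). DEVIATION (shorter in
Mathlib): we mollify, `u := φ_ε ⋆ ∇e` with a normed bump `φ_ε` of radius `ε = g₀/(2K)`
(`ContDiffBump.normed`, `HasCompactSupport.contDiff_convolution_left`,
`ContDiffBump.dist_normed_convolution_le`): `∇e` is `K`-Lipschitz (`|e|₂ ≤ K`), so `|u - ∇e| ≤ g₀/2`
and `u·∇e ≥ |∇e|(|∇e| - g₀/2) ≥ g₀²/2` where `|∇e| ≥ g₀`; periodicity, the bound `|u| ≤ K` and the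
Lipschitz constant `K` pass through the convolution. ([I] normalises `|u| = 1`; only the direction of
`u` enters the coordinates, cf. the docstring of `TubularCoords.u_transversal`.)
(iii) `Ψ` is the global flow of `u` (`Literature.Analysis.ODE.globalFlow`, jointly `C^∞` by
`Literature.Analysis.ODE.contDiff_globalFlow` — Lang, *Differential and Riemannian Manifolds*, IV §1
Thm 1.16, proved in the tree); lattice equivariance by uniqueness of integral curves.
(iv) `ρ(ω, τ) = e(Ψ(ω, τ))` has `∂ρ/∂τ = (∇e·u)(Ψ) ≥ u₀` as long as the flow line stays in the tube
`{|e| < r₀}` ((drhdta)); a flow line started in the tube therefore leaves it across `e = ±r₀` within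
time `2r₀/u₀` and, before leaving, takes every value `ρ ∈ (-r₀, r₀)` exactly once (intermediate value
theorem + strict monotonicity; `exists_unique_levelTime`). The inverse `τ = σ(ω, ρ)` is `C^k` jointly:
the map `(ω, τ) ↦ (ω, e(Ψ(ω, τ)))` is `C^k` with invertible derivative, `σ` is a left inverse of it on
the open set of tube-confined pairs `(ω, τ)`, hence agrees locally with the `C^k` local inverse of the
inverse function theorem (`ContDiffAt.to_localInverse`, `HasStrictFDerivAt.localInverse_unique`).
Finally `p(ρ, θ) := Ψ(Θ.γ(θ), σ(Θ.γ(θ), ρ))`: `e(p(ρ,θ)) = ρ`; `∂_ρ p = u/(u·∇e)` (chain rule and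
`HasDerivAt.of_local_left_inverse`); `C^k` in `(ρ, θ)` as a composition; `2π`-periodic in `θ`;
injective in `θ` on a period (two flow lines through the same point coincide, and along a tube-confined
flow line `e` vanishes only at the starting time, so the starting points on `S ∩ F` agree and `Θ` is
injective); covering (flow from `q` back to `e = 0`, take the representative of that point in `F`, use
equivariance) — [I] (iii) "`(π_⊥(q), τ(q)) = Ψ⁻¹(q)`".

## What is NOT here

* The Jacobian bounds of [I, Lemma 2.1 (iv)] with the printed constants (`|J| ≤ A₀/u₀`,
  `|∂J| ≤ A₁/u₀²`) and the inverse coordinate map `χ = Ψ⁻¹ : q ↦ (ρ, ω)` as a function on the tube —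
  not fields of `TubularCoords`, not needed by F4c's statements.
* Any instantiation at a model (the Hubbard band's hypotheses are the programme's Fermi-surface files);
  anything about the Kohn–Luttinger programme. Nothing in this file asserts or denies its hypothesis H1.
-/

noncomputable section

open Set Filter Metric MeasureTheory Function
open scoped NNReal Topology ContDiff Convolution

namespace Literature.MathematicalPhysics.QuantumLattice.FermiRG

/-! ### §1 Step (i)–(ii) of [I, Lemma 2.1]: a smooth periodic transversal field by mollification -/

section Mollify

variable {E : Type*} [NormedAddCommGroup E] [InnerProductSpace ℝ E] [FiniteDimensional ℝ E]
  [MeasurableSpace E] [BorelSpace E]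

/-- Mollification preserves lattice periodicity: if `g (x + γ) = g x` for `γ ∈ Γ`, then the same holds
for `φ ⋆ g` (translation invariance of Lebesgue measure is not even needed: the convolution integrates
`φ(t) g(x - t)`). [folklore] -/
private theorem isLatticePeriodic_normed_convolution (φ : ContDiffBump (0 : E)) {Γ : Submodule ℤ E}
    {F : Type*} [NormedAddCommGroup F] [NormedSpace ℝ F] {g : E → F} (hg : IsLatticePeriodic Γ g) :
    IsLatticePeriodic Γ (φ.normed volume ⋆[ContinuousLinearMap.lsmul ℝ ℝ, volume] g) := by
  intro γ hγ x
  rw [convolution_lsmul, convolution_lsmul]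
  refine integral_congr_ae (Eventually.of_forall fun t => ?_)
  simp only
  rw [add_sub_right_comm, hg γ hγ]

/-- The mollification of a function bounded by `K` (by a normed bump, total mass `1`) is bounded by `K`.
[folklore] -/
private theorem norm_normed_convolution_le (φ : ContDiffBump (0 : E)) {F : Type*} [NormedAddCommGroup F]
    [NormedSpace ℝ F] {g : E → F} {K : ℝ} (hK : ∀ x, ‖g x‖ ≤ K) (x : E) :
    ‖(φ.normed volume ⋆[ContinuousLinearMap.lsmul ℝ ℝ, volume] g) x‖ ≤ K := by
  rw [convolution_lsmul]
  calc ‖∫ t, φ.normed volume t • g (x - t)‖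
      ≤ ∫ t, ‖φ.normed volume t • g (x - t)‖ := norm_integral_le_integral_norm _
    _ ≤ ∫ t, φ.normed volume t * K := by
        refine integral_mono_of_nonneg (Eventually.of_forall fun t => norm_nonneg _)
          (φ.integrable_normed.mul_const K) (Eventually.of_forall fun t => ?_)
        simp only
        rw [norm_smul, Real.norm_of_nonneg (φ.nonneg_normed t)]
        exact mul_le_mul_of_nonneg_left (hK _) (φ.nonneg_normed t)
    _ = K := by rw [integral_mul_const, φ.integral_normed, one_mul]

/-- The mollification of a `K`-Lipschitz continuous function (by a normed bump) is `K`-Lipschitz.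
[folklore] -/
private theorem lipschitzWith_normed_convolution (φ : ContDiffBump (0 : E)) {F : Type*} [NormedAddCommGroup F]
    [NormedSpace ℝ F] {g : E → F} (hgc : Continuous g) {K : ℝ≥0} (hK : LipschitzWith K g) :
    LipschitzWith K (φ.normed volume ⋆[ContinuousLinearMap.lsmul ℝ ℝ, volume] g) := by
  refine LipschitzWith.of_dist_le_mul fun x y => ?_
  have hint : ∀ z : E, Integrable (fun t => φ.normed volume t • g (z - t)) volume := fun z => by
    refine Continuous.integrable_of_hasCompactSupport
      (φ.continuous_normed.smul (hgc.comp (continuous_const.sub continuous_id))) ?_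
    exact φ.hasCompactSupport_normed.smul_right
  rw [dist_eq_norm, convolution_lsmul, convolution_lsmul, ← integral_sub (hint x) (hint y)]
  calc ‖∫ t, (φ.normed volume t • g (x - t) - φ.normed volume t • g (y - t))‖
      ≤ ∫ t, ‖φ.normed volume t • g (x - t) - φ.normed volume t • g (y - t)‖ :=
        norm_integral_le_integral_norm _
    _ ≤ ∫ t, φ.normed volume t * (K * dist x y) := by
        refine integral_mono_of_nonneg (Eventually.of_forall fun t => norm_nonneg _)
          (φ.integrable_normed.mul_const _) (Eventually.of_forall fun t => ?_)
        simp only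
        rw [← smul_sub, norm_smul, Real.norm_of_nonneg (φ.nonneg_normed t)]
        refine mul_le_mul_of_nonneg_left ?_ (φ.nonneg_normed t)
        have h := hK.dist_le_mul (x - t) (y - t)
        rw [dist_eq_norm] at h
        have hd : dist (x - t) (y - t) = dist x y := by rw [dist_eq_norm, dist_eq_norm]; congr 1; abel
        rwa [hd] at h
    _ = K * dist x y := by rw [integral_mul_const, φ.integral_normed, one_mul]

/-- The mollification by a normed bump of radius `r` moves a `K`-Lipschitz function by at most `K r`.
(`ContDiffBump.dist_normed_convolution_le`.) [folklore] -/
private theorem dist_normed_convolution_self_le (φ : ContDiffBump (0 : E)) {F : Type*}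
    [NormedAddCommGroup F] [NormedSpace ℝ F] [CompleteSpace F] {g : E → F} (hgc : Continuous g)
    {K : ℝ≥0} (hK : LipschitzWith K g) (x : E) :
    dist ((φ.normed volume ⋆[ContinuousLinearMap.lsmul ℝ ℝ, volume] g) x) (g x) ≤ K * φ.rOut := by
  refine φ.dist_normed_convolution_le hgc.aestronglyMeasurable fun y hy => ?_
  exact (hK.dist_le_mul y x).trans
    (mul_le_mul_of_nonneg_left (le_of_lt (mem_ball.1 hy)) K.coe_nonneg)

variable [CompleteSpace E]

omit [FiniteDimensional ℝ E] [MeasurableSpace E] [BorelSpace E] in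
/-- `|∇e| = |De|` and `|De(p)| = ‖D¹e(p)‖`: the derivative bound `|e|₂ ≤ K` of `GeomConstants` bounds
the gradient. [folklore] -/
private theorem norm_gradient_le_of_norm_iteratedFDeriv_le {e : E → ℝ} {K : ℝ}
    (hK : ∀ p : E, ∀ j ≤ 2, ‖iteratedFDeriv ℝ j e p‖ ≤ K) (p : E) : ‖gradient e p‖ ≤ K := by
  rw [gradient, LinearIsometryEquiv.norm_map, ← norm_iteratedFDeriv_one]
  exact hK p 1 (by norm_num)

omit [FiniteDimensional ℝ E] [MeasurableSpace E] [BorelSpace E] in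
/-- A `C²` function with `‖D²e‖ ≤ K` has a `K`-Lipschitz gradient (mean value inequality).
[folklore] -/
private theorem lipschitzWith_gradient_of_norm_iteratedFDeriv_le {e : E → ℝ} (he : ContDiff ℝ 2 e) {K : ℝ}
    (hK : ∀ p : E, ∀ j ≤ 2, ‖iteratedFDeriv ℝ j e p‖ ≤ K) :
    LipschitzWith (Real.toNNReal K) (gradient e) := by
  have hdiff : ∀ x ∈ (univ : Set E), DifferentiableAt ℝ (fderiv ℝ e) x := fun x _ =>
    ((he.fderiv_right (m := 1) le_rfl).differentiable one_ne_zero) x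
  have hbound : ∀ x ∈ (univ : Set E), ‖fderiv ℝ (fderiv ℝ e) x‖ ≤ K := fun x _ => by
    rw [← norm_iteratedFDeriv_one (𝕜 := ℝ) (fderiv ℝ e), norm_iteratedFDeriv_fderiv]
    exact hK x 2 le_rfl
  refine LipschitzWith.of_dist_le_mul fun x y => ?_
  have h := convex_univ.norm_image_sub_le_of_norm_fderiv_le hdiff hbound (mem_univ y) (mem_univ x)
  rw [dist_eq_norm, dist_eq_norm, gradient, gradient, ← map_sub, LinearIsometryEquiv.norm_map]
  refine h.trans ?_
  exact mul_le_mul_of_nonneg_right (Real.le_coe_toNNReal K) (norm_nonneg _)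

/-- **[I, Lemma 2.1 (i)–(ii)]: a smooth periodic transversal field.** For a `Γ`-periodic `C²` band
`e` with `|e|₂ ≤ K` and (gzerinit) `|∇e| ≥ g₀ > 0` on the tube `{|e| < r₀}`, there is a `C^∞`,
`Γ`-periodic, bounded, globally Lipschitz vector field `u` with `u(q)·∇e(q) ≥ g₀²/2` on the tube
("`u` transversal to `S` in the sense that `u(p)·∇e(p) ≥ u₀`", [II] (uzerinit) p.8 L45–50; [I]
p.13 L40–43). [I] builds `u` from a partition of unity; here `u = φ_ε ⋆ ∇e` is the mollified
gradient with `ε = g₀/(2K)`. [cite: FeldmanSalmhoferTrubowitz1996, Lemma 2.1 (i)-(ii) (arXiv p.13 L52-64; proof p.13 L118-145)] -/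
theorem exists_smooth_transversal_field {Γ : Submodule ℤ E} {e : E → ℝ} {K r₀ g₀ : ℝ}
    (he : ContDiff ℝ 2 e) (hper : IsLatticePeriodic Γ e)
    (hK : ∀ p : E, ∀ j ≤ 2, ‖iteratedFDeriv ℝ j e p‖ ≤ K) (hg₀ : 0 < g₀)
    (hgrad : ∀ p : E, |e p| < r₀ → g₀ ≤ ‖gradient e p‖) :
    ∃ u : E → E, ContDiff ℝ (⊤ : ℕ∞) u ∧ IsLatticePeriodic Γ u ∧
      (∃ Ku : ℝ≥0, LipschitzWith Ku u) ∧ (∃ L : ℝ, ∀ q, ‖u q‖ ≤ L) ∧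
      ∀ q : E, |e q| < r₀ → g₀ ^ 2 / 2 ≤ inner ℝ (u q) (gradient e q) := by
  -- `K > 0` unless the tube is empty; treat the degenerate case first
  by_cases hempty : ∀ q : E, ¬ |e q| < r₀
  · refine ⟨fun _ => 0, contDiff_const, fun _ _ _ => rfl, ⟨0, ?_⟩, ⟨0, fun _ => by simp⟩,
      fun q hq => absurd hq (hempty q)⟩
    exact LipschitzWith.const (0 : E)
  push Not at hempty
  obtain ⟨q₀, hq₀⟩ := hempty
  have hKpos : 0 < K := lt_of_lt_of_le (hg₀.trans_le (hgrad q₀ hq₀))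
    (norm_gradient_le_of_norm_iteratedFDeriv_le hK q₀)
  -- the gradient: continuous, periodic, bounded by `K`, `K`-Lipschitz
  have hgc : Continuous (gradient e) := by
    have h1 : Continuous (fderiv ℝ e) := he.continuous_fderiv (by norm_num)
    exact (InnerProductSpace.toDual ℝ E).symm.continuous.comp h1
  have hgper : IsLatticePeriodic Γ (gradient e) := by
    intro γ hγ p
    have hshift : (fun q => e (q + γ)) = e := funext fun q => hper γ hγ q
    have hfd : fderiv ℝ e (p + γ) = fderiv ℝ e p := by
      rw [← fderiv_comp_add_right, hshift]
    simp only [gradient, hfd]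
  have hglip := lipschitzWith_gradient_of_norm_iteratedFDeriv_le he hK
  -- the bump of radius `ε = g₀/(2K)`
  set ε : ℝ := g₀ / (2 * K) with hε
  have hεpos : 0 < ε := by positivity
  let φ : ContDiffBump (0 : E) := ⟨ε / 2, ε, by positivity, by linarith⟩
  set u : E → E := φ.normed volume ⋆[ContinuousLinearMap.lsmul ℝ ℝ, volume] gradient e with hu
  refine ⟨u, ?_, isLatticePeriodic_normed_convolution φ hgper, ⟨_, lipschitzWith_normed_convolution φ
    hgc hglip⟩, ⟨K, norm_normed_convolution_le φ (norm_gradient_le_of_norm_iteratedFDeriv_le hK)⟩,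
    fun q hq => ?_⟩
  · exact φ.hasCompactSupport_normed.contDiff_convolution_left _ φ.contDiff_normed
      (hgc.locallyIntegrable (μ := volume))
  · -- `|u(q) - ∇e(q)| ≤ K ε = g₀/2`, so `u·∇e ≥ |∇e|(|∇e| - g₀/2) ≥ g₀ · g₀/2`
    have hclose : ‖u q - gradient e q‖ ≤ g₀ / 2 := by
      have h := dist_normed_convolution_self_le φ hgc hglip q
      rw [dist_eq_norm] at h
      refine h.trans ?_
      have hφ : φ.rOut = ε := rfl
      rw [hφ, Real.coe_toNNReal K hKpos.le, hε]
      field_simp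
      exact le_rfl
    have hge : g₀ ≤ ‖gradient e q‖ := hgrad q hq
    have hsplit : inner ℝ (u q) (gradient e q) =
        ‖gradient e q‖ ^ 2 + inner ℝ (u q - gradient e q) (gradient e q) := by
      rw [inner_sub_left, real_inner_self_eq_norm_sq]; ring
    have hcs : |inner ℝ (u q - gradient e q) (gradient e q)| ≤ g₀ / 2 * ‖gradient e q‖ :=
      (abs_real_inner_le_norm _ _).trans (mul_le_mul_of_nonneg_right hclose (norm_nonneg _))
    have hlow : -(g₀ / 2 * ‖gradient e q‖) ≤ inner ℝ (u q - gradient e q) (gradient e q) :=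
      (abs_le.1 hcs).1
    rw [hsplit]
    nlinarith [norm_nonneg (gradient e q)]

end Mollify

/-! ### §2 Step (iv) of [I, Lemma 2.1] in one variable: along a tube-confined flow line `e` is strictly
increasing and takes every value of `(-r₀, r₀)` exactly once -/

section LevelTime

/-- Times `t` such that the path `h` stays in the open tube `(-R, R)` on the whole time interval between
`0` and `t` form an order-connected set containing, with `t`, every time between `0` and `t`.
[folklore] -/
private theorem tubeConfined_of_mem_uIcc {h : ℝ → ℝ} {R t s : ℝ} (ht : ∀ r ∈ uIcc 0 t, |h r| < R)
    (hs : s ∈ uIcc 0 t) : ∀ r ∈ uIcc 0 s, |h r| < R :=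
  fun r hr => ht r (uIcc_subset_uIcc_left hs hr)

/-- Between two tube-confined times every time is tube-confined. [folklore] -/
private theorem tubeConfined_of_mem_Icc {h : ℝ → ℝ} {R s t r : ℝ} (hs : ∀ r ∈ uIcc 0 s, |h r| < R)
    (ht : ∀ r ∈ uIcc 0 t, |h r| < R) (hr : r ∈ uIcc s t) : ∀ r' ∈ uIcc 0 r, |h r'| < R := by
  rcases uIcc_subset_uIcc_union_uIcc (b := (0 : ℝ)) hr with h0 | h0
  · exact tubeConfined_of_mem_uIcc hs (by rwa [uIcc_comm] at h0)
  · exact tubeConfined_of_mem_uIcc ht h0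

/-- **(drhdta) integrated**: if `h' ≥ u₀` at every tube-confined time, then `u₀ (t - s) ≤ h t - h s` for
tube-confined `s ≤ t` ([I] p.13 L160–161 with the display p.14 L1–8: "`e(q) = ∫₀^τ (u·∇e)(γ(t)) dt
≥ u₀ τ`"). [cite: FeldmanSalmhoferTrubowitz1996, Lemma 2.1 (iii) proof (arXiv p.13 L160-161, p.14 L1-8)] -/
theorem mul_sub_le_sub_of_tubeConfined {h h' : ℝ → ℝ} {R u₀ : ℝ}
    (hder : ∀ t, (∀ r ∈ uIcc 0 t, |h r| < R) → HasDerivAt h (h' t) t)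
    (hge : ∀ t, (∀ r ∈ uIcc 0 t, |h r| < R) → u₀ ≤ h' t) {s t : ℝ}
    (hs : ∀ r ∈ uIcc 0 s, |h r| < R) (ht : ∀ r ∈ uIcc 0 t, |h r| < R) (hst : s ≤ t) :
    u₀ * (t - s) ≤ h t - h s := by
  have hconf : ∀ r ∈ Icc s t, ∀ r' ∈ uIcc 0 r, |h r'| < R := fun r hr =>
    tubeConfined_of_mem_Icc hs ht (by rwa [uIcc_of_le hst])
  have hderiv : ∀ r ∈ Icc s t, HasDerivAt h (h' r) r := fun r hr => hder r (hconf r hr)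
  have hcont : ContinuousOn h (Icc s t) := fun r hr => (hderiv r hr).continuousAt.continuousWithinAt
  have hdiff : DifferentiableOn ℝ h (interior (Icc s t)) := fun r hr =>
    (hderiv r (interior_subset hr)).differentiableAt.differentiableWithinAt
  have hge' : ∀ r ∈ interior (Icc s t), u₀ ≤ deriv h r := fun r hr => by
    rw [(hderiv r (interior_subset hr)).deriv]
    exact hge r (hconf r (interior_subset hr))
  exact (convex_Icc s t).mul_sub_le_image_sub_of_le_deriv hcont hdiff hge' s
    (left_mem_Icc.2 hst) t (right_mem_Icc.2 hst) hst

/-- Uniqueness of the level time: two tube-confined times with the same level coincide.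
[cite: FeldmanSalmhoferTrubowitz1996, Lemma 2.1 (iv) (arXiv p.14 L12-24)] -/
theorem eq_of_tubeConfined_of_eq {h h' : ℝ → ℝ} {R u₀ : ℝ} (hu₀ : 0 < u₀)
    (hder : ∀ t, (∀ r ∈ uIcc 0 t, |h r| < R) → HasDerivAt h (h' t) t)
    (hge : ∀ t, (∀ r ∈ uIcc 0 t, |h r| < R) → u₀ ≤ h' t) {s t : ℝ}
    (hs : ∀ r ∈ uIcc 0 s, |h r| < R) (ht : ∀ r ∈ uIcc 0 t, |h r| < R) (hst : h s = h t) :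
    s = t := by
  rcases le_total s t with hle | hle
  · have h1 := mul_sub_le_sub_of_tubeConfined hder hge hs ht hle
    rw [hst, sub_self] at h1
    nlinarith
  · have h1 := mul_sub_le_sub_of_tubeConfined hder hge ht hs hle
    rw [hst, sub_self] at h1
    nlinarith

/-- The forward half of the level-time existence: every `ρ ∈ [h 0, R)` is attained at a tube-confined
time `t ≥ 0` (the flow line cannot stay in the tube beyond time `2R/u₀`; before it leaves, the
intermediate value theorem applies). [cite: FeldmanSalmhoferTrubowitz1996, Lemma 2.1 (iv) (arXiv p.14 L12-24)] -/
theorem exists_tubeConfined_eq_of_le {h h' : ℝ → ℝ} {R u₀ : ℝ} (hu₀ : 0 < u₀) (hcont : Continuous h)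
    (h0 : |h 0| < R) (hder : ∀ t, (∀ r ∈ uIcc 0 t, |h r| < R) → HasDerivAt h (h' t) t)
    (hge : ∀ t, (∀ r ∈ uIcc 0 t, |h r| < R) → u₀ ≤ h' t) {ρ : ℝ} (hρ0 : h 0 ≤ ρ) (hρR : ρ < R) :
    ∃ t, 0 ≤ t ∧ (∀ r ∈ uIcc 0 t, |h r| < R) ∧ h t = ρ := by
  have hR : 0 < R := lt_of_le_of_lt (abs_nonneg _) h0
  have hconf0 : ∀ r ∈ uIcc (0 : ℝ) 0, |h r| < R := fun r hr => by
    rw [uIcc_self, mem_singleton_iff] at hr; rw [hr]; exact h0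
  -- the flow line leaves the tube before time `t₁ = 2R/u₀`
  set t₁ : ℝ := 2 * R / u₀ + 1 with ht₁
  have ht₁pos : 0 < t₁ := by positivity
  set A : Set ℝ := {s | s ∈ Icc 0 t₁ ∧ R ≤ |h s|} with hA
  have hAne : A.Nonempty := by
    by_contra hne
    rw [not_nonempty_iff_eq_empty] at hne
    have hall : ∀ r ∈ uIcc 0 t₁, |h r| < R := fun r hr => by
      rw [uIcc_of_le ht₁pos.le] at hr
      by_contra hlt
      have : r ∈ A := ⟨hr, not_lt.1 hlt⟩
      rw [hne] at this; exact this
    have h1 := mul_sub_le_sub_of_tubeConfined hder hge hconf0 hall ht₁pos.le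
    have h2 : h t₁ < R := (abs_lt.1 (hall t₁ (by rw [uIcc_of_le ht₁pos.le]; exact right_mem_Icc.2 ht₁pos.le))).2
    have h3 : -R < h 0 := (abs_lt.1 h0).1
    have h4 : u₀ * t₁ = 2 * R + u₀ := by rw [ht₁]; field_simp
    nlinarith
  have hAclosed : IsClosed A := by
    have : A = Icc 0 t₁ ∩ (fun s => |h s|) ⁻¹' Ici R := by
      ext s; simp [hA, mem_Ici]
    rw [this]
    exact isClosed_Icc.inter (isClosed_Ici.preimage (continuous_abs.comp hcont))
  have hAbdd : BddBelow A := ⟨0, fun s hs => hs.1.1⟩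
  set s₀ := sInf A with hs₀
  have hs₀A : s₀ ∈ A := hAclosed.csInf_mem hAne hAbdd
  have hs₀le : ∀ s ∈ A, s₀ ≤ s := fun s hs => csInf_le hAbdd hs
  have hs₀nn : 0 ≤ s₀ := hs₀A.1.1
  have hs₀pos : 0 < s₀ := by
    rcases hs₀nn.eq_or_lt with h | h
    · exfalso; have := hs₀A.2; rw [← h] at this; exact absurd h0 (not_lt.2 this)
    · exact h
  -- before `s₀` the flow line is in the tube
  have hbefore : ∀ s, 0 ≤ s → s < s₀ → ∀ r ∈ uIcc 0 s, |h r| < R := by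
    intro s hs0 hss r hr
    rw [uIcc_of_le hs0] at hr
    by_contra hlt
    have hrA : r ∈ A := ⟨⟨hr.1, by linarith [hr.2, hs₀A.1.2]⟩, not_lt.1 hlt⟩
    linarith [hs₀le r hrA, hr.2]
  have hmono : ∀ s, 0 ≤ s → s < s₀ → h 0 ≤ h s := fun s hs0 hss => by
    have := mul_sub_le_sub_of_tubeConfined hder hge hconf0 (hbefore s hs0 hss) hs0
    nlinarith
  have hcontOn : ContinuousOn h (Icc 0 s₀) := hcont.continuousOn
  -- `h s₀ ≥ R`: the other sign contradicts monotonicity via the intermediate value theorem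
  have hs₀val : R ≤ h s₀ := by
    by_contra hlt
    push Not at hlt
    have hneg : h s₀ ≤ -R := by
      have := hs₀A.2
      rcases le_abs.1 this with h1 | h1
      · exact absurd h1 (not_le.2 hlt)
      · linarith
    -- the value `(h 0 + h s₀)/2 < h 0` is attained on `[0, s₀)`
    have hlo : -R < h 0 := (abs_lt.1 h0).1
    set v : ℝ := (h 0 + h s₀) / 2 with hv
    have hvmem : v ∈ Icc (h s₀) (h 0) := ⟨by rw [hv]; linarith, by rw [hv]; linarith⟩
    obtain ⟨t, htI, htv⟩ := intermediate_value_Icc' hs₀nn hcontOn hvmem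
    have htne : t ≠ s₀ := by
      rintro rfl; rw [htv, hv] at hneg; linarith
    have htlt : t < s₀ := lt_of_le_of_ne htI.2 htne
    have := hmono t htI.1 htlt
    rw [htv, hv] at this; linarith
  -- intermediate value theorem on `[0, s₀]`
  have hvmem : ρ ∈ Icc (h 0) (h s₀) := ⟨hρ0, hρR.le.trans hs₀val⟩
  obtain ⟨t, htI, htv⟩ := intermediate_value_Icc hs₀nn hcontOn hvmem
  have htne : t ≠ s₀ := by rintro rfl; rw [htv] at hs₀val; linarith
  exact ⟨t, htI.1, hbefore t htI.1 (lt_of_le_of_ne htI.2 htne), htv⟩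

/-- **[I, Lemma 2.1 (iv)], one flow line**: if `h` is continuous, `|h 0| < R`, and `h' ≥ u₀ > 0` at every
tube-confined time, then every level `ρ ∈ (-R, R)` is attained at exactly one tube-confined time (the
backward half follows from the forward half applied to `t ↦ -h(-t)`).
[cite: FeldmanSalmhoferTrubowitz1996, Lemma 2.1 (iv) (arXiv p.14 L12-24)] -/
theorem exists_unique_levelTime {h h' : ℝ → ℝ} {R u₀ : ℝ} (hu₀ : 0 < u₀) (hcont : Continuous h)
    (h0 : |h 0| < R) (hder : ∀ t, (∀ r ∈ uIcc 0 t, |h r| < R) → HasDerivAt h (h' t) t)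
    (hge : ∀ t, (∀ r ∈ uIcc 0 t, |h r| < R) → u₀ ≤ h' t) {ρ : ℝ} (hρ : ρ ∈ Ioo (-R) R) :
    ∃! t, (∀ r ∈ uIcc 0 t, |h r| < R) ∧ h t = ρ := by
  refine existsUnique_of_exists_of_unique ?_ fun s t hs ht =>
    eq_of_tubeConfined_of_eq hu₀ hder hge hs.1 ht.1 (hs.2.trans ht.2.symm)
  rcases le_or_gt (h 0) ρ with hle | hlt
  · obtain ⟨t, -, ht, htv⟩ := exists_tubeConfined_eq_of_le hu₀ hcont h0 hder hge hle hρ.2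
    exact ⟨t, ht, htv⟩
  · -- reflect: `k t = -h (-t)`
    set k : ℝ → ℝ := fun t => -h (-t) with hk
    have hkcont : Continuous k := (hcont.comp continuous_neg).neg
    have hk0 : |k 0| < R := by simp [hk, h0]
    have hconf : ∀ t, (∀ r ∈ uIcc 0 t, |k r| < R) → ∀ r ∈ uIcc 0 (-t), |h r| < R := by
      intro t ht r hr
      have : -r ∈ uIcc 0 t := by
        rw [mem_uIcc] at hr ⊢
        rcases hr with ⟨h1, h2⟩ | ⟨h1, h2⟩
        · right; constructor <;> linarith
        · left; constructor <;> linarith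
      have h1 := ht (-r) this
      simpa [hk, abs_neg] using h1
    have hkder : ∀ t, (∀ r ∈ uIcc 0 t, |k r| < R) → HasDerivAt k (h' (-t)) t := by
      intro t ht
      have h1 : HasDerivAt h (h' (-t)) (-t) := hder (-t) (hconf t ht)
      have h2 : HasDerivAt (fun s => h (-s)) (h' (-t) * -1) t := h1.comp t (hasDerivAt_neg t)
      have h3 := h2.neg
      have h4 : -(h' (-t) * -1) = h' (-t) := by ring
      rw [h4] at h3
      exact h3
    have hkge : ∀ t, (∀ r ∈ uIcc 0 t, |k r| < R) → u₀ ≤ h' (-t) := fun t ht => hge (-t) (hconf t ht)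
    have hle : k 0 ≤ -ρ := by simp [hk]; linarith
    have hρ' : -ρ < R := by linarith [hρ.1]
    obtain ⟨t, -, ht, htv⟩ := exists_tubeConfined_eq_of_le (h' := fun t => h' (-t)) hu₀ hkcont hk0
      hkder hkge hle hρ'
    refine ⟨-t, hconf t ht, ?_⟩
    simp only [hk, neg_inj] at htv
    linarith [htv]

end LevelTime

/-- The set of tube-confined pairs `(x, t)` — the path `r ↦ G(x, r)` stays in `(-R, R)` for all `r`
between `0` and `t` — is open, for `G` continuous (compactness of the time segment).
[folklore] -/
private theorem isOpen_tubeConfined {X : Type*} [TopologicalSpace X] {G : X × ℝ → ℝ} (hG : Continuous G)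
    (R : ℝ) : IsOpen {p : X × ℝ | ∀ r ∈ uIcc 0 p.2, |G (p.1, r)| < R} := by
  rw [isOpen_iff_mem_nhds]
  rintro ⟨x, t⟩ hxt
  have hU : IsOpen {q : X × ℝ | |G q| < R} := isOpen_lt (continuous_abs.comp hG) continuous_const
  have hsub : ({x} : Set X) ×ˢ uIcc 0 t ⊆ {q : X × ℝ | |G q| < R} := by
    rintro ⟨y, r⟩ ⟨hy, hr⟩
    rw [mem_singleton_iff] at hy
    subst hy
    exact hxt r hr
  obtain ⟨A, B, hA, hB, hxA, htB, hAB⟩ :=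
    generalized_tube_lemma isCompact_singleton isCompact_uIcc hU hsub
  obtain ⟨δ, hδ, hthick⟩ := (isCompact_uIcc (a := (0 : ℝ)) (b := t)).exists_cthickening_subset_open hB htB
  have hA' : A ∈ 𝓝 x := hA.mem_nhds (hxA (mem_singleton x))
  have hI : Ioo (t - δ) (t + δ) ∈ 𝓝 t := Ioo_mem_nhds (by linarith) (by linarith)
  filter_upwards [prod_mem_nhds hA' hI] with q hq r hr
  obtain ⟨hy, ht'⟩ := hq
  have hrB : r ∈ B := by
    apply hthick
    rcases uIcc_subset_uIcc_union_uIcc (b := t) hr with h1 | h1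
    · exact self_subset_cthickening _ h1
    · refine mem_cthickening_of_dist_le r t δ (uIcc 0 t) right_mem_uIcc ?_
      rw [Real.dist_eq]
      have h2 := abs_sub_left_of_mem_uIcc h1
      have h3 : |q.2 - t| < δ := abs_sub_lt_iff.2 ⟨by linarith [ht'.2], by linarith [ht'.1]⟩
      linarith
  exact hAB (mk_mem_prod hy hrB)

/-! ### §3 Step (iii) of [I, Lemma 2.1]: the flow of the transversal field and its lattice equivariance -/

section Flow

open Literature.Analysis.ODE

variable {E : Type*} [NormedAddCommGroup E] [NormedSpace ℝ E] [CompleteSpace E]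

/-- **Lattice equivariance of the flow.** If the field `u` is invariant under translation by `c`, so is
its global flow: `Ψ(x + c, t) = Ψ(x, t) + c` (uniqueness of integral curves; [I, Lemma 2.1]: `u`, `Ψ`
live on the torus `𝓑 = ℝ^d/Γ#`). [cite: FeldmanSalmhoferTrubowitz1996, Lemma 2.1 (i) (arXiv p.13 L52-58)] -/
theorem globalFlow_add_const {u : E → E} {Ku : ℝ≥0} {Lu : ℝ} (hKu : LipschitzWith Ku u)
    (hLu : ∀ q, ‖u q‖ ≤ Lu) {c : E} (hc : ∀ x, u (x + c) = u x) (x : E) (t : ℝ) :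
    globalFlow hKu hLu (x + c) t = globalFlow hKu hLu x t + c := by
  set γ : ℝ → E := fun s => globalFlow hKu hLu x s + c with hγ
  have hγd : ∀ s ∈ Ioo (-(|t| + 1)) (|t| + 1), HasDerivAt γ (u (γ s)) s := fun s _ => by
    have h1 := (hasDerivAt_globalFlow hKu hLu x s).add_const c
    have h2 : u (γ s) = u (globalFlow hKu hLu x s) := hc _
    rw [h2]
    exact h1
  have h0 : (0 : ℝ) ∈ Ioo (-(|t| + 1)) (|t| + 1) := ⟨by linarith [abs_nonneg t], by linarith [abs_nonneg t]⟩
  have ht : t ∈ Ioo (-(|t| + 1)) (|t| + 1) := by constructor <;> cases abs_cases t <;> linarith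
  have heq := eqOn_globalFlow hKu hLu h0 hγd ht
  have hγ0 : γ 0 = x + c := by simp [hγ]
  rw [hγ0] at heq
  exact heq.symm

end Flow

/-! ### §4 Step (iv) of [I, Lemma 2.1]: the time-to-level map is `C^k` (inverse function theorem) -/

section IFT

variable {E : Type*} [NormedAddCommGroup E] [NormedSpace ℝ E] [CompleteSpace E]

/-- **The inverse of `(ω, τ) ↦ (ω, ρ(ω, τ))` is `C^n`.** Let `g : E × ℝ → ℝ` be `C^n` (`n ≥ 1`) at a
point `a` of an open set `Ω` with `∂_t g(a) ≠ 0`, and let `σ` invert `g` in the time variable on `Ω`: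
`σ(x, g(x, t)) = t` for `(x, t) ∈ Ω`. Then `σ` is `C^n` at `(a.1, g a)` — it agrees near that point with
the local inverse of `(x, t) ↦ (x, g(x, t))` given by the inverse function theorem ([I] p.14 L12–24:
"the map is a diffeomorphism because it is the composition of `Ψ` with the inverse of
`(ω, τ) ↦ (ω, ρ) = (ω, e(Ψ(ω, τ)))` and because `∂ρ/∂τ = (∇e·u)(Ψ(ω,τ)) ≥ u₀`").
[cite: FeldmanSalmhoferTrubowitz1996, Lemma 2.1 (iv) (arXiv p.14 L12-24)] -/
theorem contDiffAt_leftInverse_of_levelMap {n : WithTop ℕ∞} (hn : 1 ≤ n) {g σ : E × ℝ → ℝ}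
    {Ω : Set (E × ℝ)} (hΩ : IsOpen Ω) {a : E × ℝ} (ha : a ∈ Ω) (hg : ContDiffAt ℝ n g a)
    (hdt : fderiv ℝ g a ((0 : E), (1 : ℝ)) ≠ 0) (hleft : ∀ p ∈ Ω, σ (p.1, g p) = p.2) :
    ContDiffAt ℝ n σ (a.1, g a) := by
  have hn0 : n ≠ 0 := ne_of_gt (lt_of_lt_of_le zero_lt_one hn)
  set Ψ : E × ℝ → E × ℝ := fun p => (p.1, g p) with hΨ
  set Dg : E × ℝ →L[ℝ] ℝ := fderiv ℝ g a with hDg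
  set c : ℝ := Dg ((0 : E), (1 : ℝ)) with hc
  have hc0 : c ≠ 0 := hdt
  set L : E × ℝ →L[ℝ] E × ℝ := (ContinuousLinearMap.fst ℝ E ℝ).prod Dg with hL
  set M : E × ℝ →L[ℝ] E × ℝ := (ContinuousLinearMap.fst ℝ E ℝ).prod
      (c⁻¹ • (ContinuousLinearMap.snd ℝ E ℝ -
        Dg.comp ((ContinuousLinearMap.inl ℝ E ℝ).comp (ContinuousLinearMap.fst ℝ E ℝ)))) with hM
  have hsplit : ∀ (y : E) (r : ℝ), Dg (y, r) = Dg (y, 0) + r * c := by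
    intro y r
    have h1 : ((y, r) : E × ℝ) = (y, 0) + r • ((0 : E), (1 : ℝ)) := by ext <;> simp
    rw [h1, map_add, map_smul, smul_eq_mul]
  have hML : Function.LeftInverse M L := by
    rintro ⟨y, r⟩
    simp only [hM, hL, ContinuousLinearMap.prod_apply, ContinuousLinearMap.coe_fst',
      _root_.smul_apply, _root_.sub_apply,
      ContinuousLinearMap.coe_snd', ContinuousLinearMap.comp_apply,
      ContinuousLinearMap.inl_apply, smul_eq_mul, Prod.mk.injEq, true_and]
    rw [hsplit y r]
    field_simp
    ring
  have hLM : Function.RightInverse M L := by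
    rintro ⟨y, r⟩
    simp only [hM, hL, ContinuousLinearMap.prod_apply, ContinuousLinearMap.coe_fst',
      _root_.smul_apply, _root_.sub_apply,
      ContinuousLinearMap.coe_snd', ContinuousLinearMap.comp_apply,
      ContinuousLinearMap.inl_apply, smul_eq_mul, Prod.mk.injEq, true_and]
    rw [hsplit y (c⁻¹ * (r - Dg (y, 0)))]
    field_simp
    ring
  let f' : (E × ℝ) ≃L[ℝ] (E × ℝ) := ContinuousLinearEquiv.equivOfInverse L M hML hLM
  have hΨd : HasFDerivAt Ψ (f' : E × ℝ →L[ℝ] E × ℝ) a :=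
    hasFDerivAt_fst.prodMk (hg.differentiableAt hn0).hasFDerivAt
  have hΨc : ContDiffAt ℝ n Ψ a := contDiffAt_fst.prodMk hg
  have hstrict : HasStrictFDerivAt Ψ (f' : E × ℝ →L[ℝ] E × ℝ) a := hΨc.hasStrictFDerivAt' hΨd hn0
  set G : E × ℝ → E × ℝ := fun q => (q.1, σ q) with hG
  have hGleft : ∀ᶠ p in 𝓝 a, G (Ψ p) = p := by
    filter_upwards [hΩ.mem_nhds ha] with p hp
    simp only [hG, hΨ, hleft p hp]
  have hGeq : ∀ᶠ y in 𝓝 (Ψ a), G y = hstrict.localInverse Ψ f' a y :=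
    hstrict.localInverse_unique hGleft
  have hinvC : ContDiffAt ℝ n (hΨc.localInverse hΨd hn0) (Ψ a) := hΨc.to_localInverse hΨd hn0
  have hGC : ContDiffAt ℝ n G (Ψ a) := hinvC.congr_of_eventuallyEq hGeq
  have h2 : ContDiffAt ℝ n (fun q => (G q).2) (Ψ a) := contDiffAt_snd.comp _ hGC
  exact h2

end IFT

/-! ### §5 Assembly: the coordinate datum `TubularCoords` of [II] §2.2 exists -/

section Assembly

open Literature.Analysis.ODE

variable {E : Type*} [NormedAddCommGroup E] [InnerProductSpace ℝ E] [CompleteSpace E]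
  [FiniteDimensional ℝ E] [MeasurableSpace E] [BorelSpace E]

/-- **[I, Lemma 2.1] (explicit tube): the tubular coordinates exist, with prescribed angular
coordinate.** [I] Lemma 2.1 (ii): "There are `δ > 0` and `u₀ ∈ (0,1)` such that
`U_{2δ}(S)‾ ⊂ Ψ(S × (-ε, ε))`, and such that for all `q ∈ U_{2δ}(S)`:
`0 < g₀/2 ≤ u₀ ≤ ∇e(q)·u(q) ≤ G₀`" (p.13 L59–64) and (iv): "the map `χ : p ↦ (ρ, ω)` is a
`C^k`-diffeomorphism" (p.13 L89–94). Typed over the tube `{|e| < 2r}` ([II] §2.2: `𝒜 = (-2r₀, 2r₀) × S`,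
p.8 L36): if `e` is (A2)_{k,h} with `k ≥ 2`, `|e|₂ ≤ K`, and `|∇e| ≥ g₀ > 0` on `{|e| < 2r}`, then every
angular coordinate `Θ` of `S ∩ F` with `C^k` curve extends to a coordinate datum `TubularCoords cr e k r`
whose `ρ = 0` slice is `Θ`. Valid in any dimension (the two-dimensionality sits in `Θ`).
[cite: FeldmanSalmhoferTrubowitz1996, Lemma 2.1 (ii), (iv) (arXiv p.13 L59-64, L89-94)] -/
theorem exists_tubularCoords_of_gradient_bound (cr : Crystal E) {e : E → ℝ} {k : ℕ} {h : ℝ≥0}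
    {K r g₀ : ℝ} (hk : 2 ≤ k) (hA2 : HypA2 cr k h e)
    (hK : ∀ p : E, ∀ j ≤ 2, ‖iteratedFDeriv ℝ j e p‖ ≤ K) (hr : 0 < r) (hg₀ : 0 < g₀)
    (hgrad : ∀ p : E, |e p| < 2 * r → g₀ ≤ ‖gradient e p‖)
    (Θ : FermiCurveParam cr e) (hΘ : ContDiff ℝ k Θ.γ) :
    ∃ Φ : TubularCoords cr e k r, Φ.base = Θ := by
  classical
  set r₀ : ℝ := 2 * r with hr₀def
  have hr₀ : 0 < r₀ := by positivity
  have hk1 : (1 : WithTop ℕ∞) ≤ (k : WithTop ℕ∞) := by exact_mod_cast (one_le_two.trans hk)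
  have hk0 : (k : WithTop ℕ∞) ≠ 0 := ne_of_gt (lt_of_lt_of_le zero_lt_one hk1)
  have he : ContDiff ℝ k e := hA2.memContDiffHolder.contDiff
  have he2 : ContDiff ℝ 2 e := he.of_le (by exact_mod_cast hk)
  have hediff : Differentiable ℝ e := he.differentiable hk0
  -- Step (i)–(ii): the smooth periodic transversal field
  obtain ⟨u, hu, huper, ⟨Ku, hKu⟩, ⟨Lu, hLu⟩, htrans⟩ := exists_smooth_transversal_field
    (Γ := cr.dualLattice) (r₀ := r₀) he2 hA2.periodic hK hg₀ hgrad
  set u₀ : ℝ := g₀ ^ 2 / 2 with hu₀def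
  have hu₀ : 0 < u₀ := by positivity
  have htrans' : ∀ q, |e q| < r₀ → u₀ ≤ fderiv ℝ e q (u q) := fun q hq => by
    rw [← inner_gradient_left, real_inner_comm]
    exact htrans q hq
  -- Step (iii): the flow
  set ψ : E → ℝ → E := globalFlow hKu hLu with hψ
  have hψ0 : ∀ x, ψ x 0 = x := globalFlow_zero hKu hLu
  have hψd : ∀ x t, HasDerivAt (ψ x) (u (ψ x t)) t := hasDerivAt_globalFlow hKu hLu
  have hψadd : ∀ x s t, ψ x (s + t) = ψ (ψ x s) t := globalFlow_add hKu hLu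
  have hψC : ContDiff ℝ ((⊤ : ℕ∞) : WithTop ℕ∞) (fun p : E × ℝ => ψ p.1 p.2) :=
    contDiff_globalFlow hu le_top hKu hLu
  have hψCk : ContDiff ℝ k (fun p : E × ℝ => ψ p.1 p.2) := hψC.of_le (by exact_mod_cast le_top)
  have hψequiv : ∀ γ ∈ cr.dualLattice, ∀ x t, ψ (x + γ) t = ψ x t + γ := fun γ hγ x t =>
    globalFlow_add_const hKu hLu (fun y => huper γ hγ y) x t
  -- the level along the flow lines
  set g : E × ℝ → ℝ := fun p => e (ψ p.1 p.2) with hgdef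
  have hgC : ContDiff ℝ k g := he.comp hψCk
  have hgcont : Continuous g := hgC.continuous
  have hgd : ∀ x t, HasDerivAt (fun s => g (x, s)) (fderiv ℝ e (ψ x t) (u (ψ x t))) t :=
    fun x t => (hediff _).hasFDerivAt.comp_hasDerivAt t (hψd x t)
  have hpartial : ∀ x t, fderiv ℝ g (x, t) ((0 : E), (1 : ℝ)) = fderiv ℝ e (ψ x t) (u (ψ x t)) := by
    intro x t
    have h1 : HasDerivAt (fun s : ℝ => ((x, s) : E × ℝ)) ((0 : E), (1 : ℝ)) t :=
      (hasDerivAt_const t x).prodMk (hasDerivAt_id t)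
    have h2 : HasDerivAt (fun s => g (x, s)) (fderiv ℝ g (x, t) ((0 : E), (1 : ℝ))) t :=
      ((hgC.differentiable hk0) (x, t)).hasFDerivAt.comp_hasDerivAt t h1
    exact h2.unique (hgd x t)
  -- tube confinement
  have hconf_line : ∀ x t, (∀ r ∈ uIcc 0 t, |g (x, r)| < r₀) → u₀ ≤ fderiv ℝ e (ψ x t) (u (ψ x t)) :=
    fun x t ht => htrans' _ (ht t right_mem_uIcc)
  have huniq : ∀ x s t, (∀ r ∈ uIcc 0 s, |g (x, r)| < r₀) → (∀ r ∈ uIcc 0 t, |g (x, r)| < r₀) →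
      g (x, s) = g (x, t) → s = t := fun x s t hs ht hst =>
    eq_of_tubeConfined_of_eq (h := fun r => g (x, r)) hu₀ (fun r _ => hgd x r) (hconf_line x) hs ht hst
  have hline : ∀ x, |e x| < r₀ → ∀ ρ ∈ Ioo (-r₀) r₀,
      ∃ t, (∀ r ∈ uIcc 0 t, |g (x, r)| < r₀) ∧ g (x, t) = ρ := by
    intro x hx ρ hρ
    have h0 : |g (x, 0)| < r₀ := by simpa [hgdef, hψ0] using hx
    have hcx : Continuous fun r => g (x, r) := hgcont.comp (continuous_const.prodMk continuous_id)
    exact (exists_unique_levelTime hu₀ hcx h0 (fun r _ => hgd x r) (hconf_line x) hρ).exists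
  have hline' : ∀ (x : E) (ρ : ℝ), ∃ t : ℝ, |e x| < r₀ → ρ ∈ Ioo (-r₀) r₀ →
      (∀ r ∈ uIcc 0 t, |g (x, r)| < r₀) ∧ g (x, t) = ρ := by
    intro x ρ
    by_cases hx : |e x| < r₀
    · by_cases hρ : ρ ∈ Ioo (-r₀) r₀
      · obtain ⟨t, ht⟩ := hline x hx ρ hρ
        exact ⟨t, fun _ _ => ht⟩
      · exact ⟨0, fun _ h' => absurd h' hρ⟩
    · exact ⟨0, fun h' => absurd h' hx⟩
  choose σ hσ using hline'
  -- (K1) `σ` inverts `g` in time on tube-confined pairs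
  have hK1 : ∀ x t, (∀ r ∈ uIcc 0 t, |g (x, r)| < r₀) → σ x (g (x, t)) = t := by
    intro x t ht
    have hx : |e x| < r₀ := by simpa [hgdef, hψ0] using ht 0 left_mem_uIcc
    have hρ : g (x, t) ∈ Ioo (-r₀) r₀ := abs_lt.1 (ht t right_mem_uIcc)
    obtain ⟨h1, h2⟩ := hσ x (g (x, t)) hx hρ
    exact huniq x _ _ h1 ht h2
  -- the open set of tube-confined pairs and the smoothness of `σ`
  set Ω : Set (E × ℝ) := {p | ∀ r ∈ uIcc 0 p.2, |g (p.1, r)| < r₀} with hΩ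
  have hΩopen : IsOpen Ω := isOpen_tubeConfined hgcont r₀
  set σ' : E × ℝ → ℝ := fun q => σ q.1 q.2 with hσ'
  have hσ'C : ∀ x ρ, |e x| < r₀ → ρ ∈ Ioo (-r₀) r₀ → ContDiffAt ℝ k σ' (x, ρ) := by
    intro x ρ hx hρ
    obtain ⟨hconf, hlev⟩ := hσ x ρ hx hρ
    have ha : ((x, σ x ρ) : E × ℝ) ∈ Ω := hconf
    have hdt : fderiv ℝ g (x, σ x ρ) ((0 : E), (1 : ℝ)) ≠ 0 := by
      rw [hpartial]
      exact ne_of_gt (lt_of_lt_of_le hu₀ (hconf_line x _ hconf))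
    have h1 := contDiffAt_leftInverse_of_levelMap (σ := σ') hk1 hΩopen ha hgC.contDiffAt hdt
      (fun p hp => hK1 p.1 p.2 hp)
    simpa [hlev] using h1
  -- the angular coordinate: points of `S ∩ F`
  have hγ0 : ∀ θ, e (Θ.γ θ) = 0 := fun θ => (Θ.mem θ).1
  have hγtube : ∀ θ, |e (Θ.γ θ)| < r₀ := fun θ => by rw [hγ0]; simpa using hr₀
  have hr2 : 2 * r = r₀ := hr₀def.symm
  -- the coordinates
  set p : ℝ → ℝ → E := fun ρ θ => ψ (Θ.γ θ) (σ (Θ.γ θ) ρ) with hpdef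
  have hσ0 : ∀ θ, σ (Θ.γ θ) 0 = 0 := fun θ => by
    have h1 : ∀ r ∈ uIcc (0 : ℝ) 0, |g (Θ.γ θ, r)| < r₀ := fun r hr => by
      rw [uIcc_self, mem_singleton_iff] at hr
      rw [hr]; simpa [hgdef, hψ0] using hγtube θ
    have h2 := hK1 (Θ.γ θ) 0 h1
    simpa [hgdef, hψ0, hγ0] using h2
  have htube2 : ∀ q : E, |e q| < 2 * r → u₀ ≤ inner ℝ (u q) (gradient e q) :=
    fun q hq => htrans q (by rwa [hr2] at hq)
  -- fields in declaration order: p, u, base, r₀_pos, p_zero, u_contDiff, u_periodic, u_transversal,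
  -- hasDerivAt_rho, level, periodic, contDiffOn, injOn, covers
  refine ⟨⟨p, u, Θ, hr, ?_, hu, huper, ⟨u₀, hu₀, htube2⟩, ?_, ?_, ?_, ?_, ?_, ?_⟩, rfl⟩
  · -- `p 0 = Θ.γ`
    funext θ
    simp only [hpdef, hσ0, hψ0]
  · -- `∂_ρ p = u/(u·∇e)`
    intro θ ρ hρ
    rw [hr2] at hρ
    set x := Θ.γ θ with hx
    obtain ⟨hconf, hlev⟩ := hσ x ρ (hγtube θ) hρ
    set t := σ x ρ with ht
    set c : ℝ := fderiv ℝ e (ψ x t) (u (ψ x t)) with hcdef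
    have hcpos : 0 < c := lt_of_lt_of_le hu₀ (hconf_line x t hconf)
    have hσcont : ContinuousAt (σ x) ρ := by
      have h1 := (hσ'C x ρ (hγtube θ) hρ).continuousAt
      exact h1.comp (continuousAt_const.prodMk continuousAt_id)
    have hfg : ∀ᶠ y in 𝓝 ρ, g (x, σ x y) = y := by
      filter_upwards [Ioo_mem_nhds hρ.1 hρ.2] with y hy
      exact (hσ x y (hγtube θ) hy).2
    have hσd : HasDerivAt (σ x) c⁻¹ ρ :=
      HasDerivAt.of_local_left_inverse hσcont (by rw [← ht]; exact hgd x t) hcpos.ne' hfg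
    have hcomp : HasDerivAt (fun ρ' => ψ x (σ x ρ')) (c⁻¹ • u (ψ x t)) ρ := (hψd x t).scomp ρ hσd
    have hc_inner : c = inner ℝ (u (ψ x t)) (gradient e (ψ x t)) := by
      rw [hcdef, ← inner_gradient_left, real_inner_comm]
    simpa [hpdef, ← hx, ← ht, hc_inner] using hcomp
  · -- `e (p ρ θ) = ρ`
    intro θ ρ hρ
    rw [hr2] at hρ
    exact (hσ (Θ.γ θ) ρ (hγtube θ) hρ).2
  · -- `2π`-periodicity in `θ`
    intro ρ θ
    simp only [hpdef, Θ.periodic θ]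
  · -- `C^k` on the strip
    rw [hr2]
    have hinner : ContDiffOn ℝ k (fun z : ℝ × ℝ => ((Θ.γ z.2, σ' (Θ.γ z.2, z.1)) : E × ℝ))
        (Ioo (-r₀) r₀ ×ˢ univ) := by
      refine ContDiffOn.prodMk (hΘ.comp contDiff_snd).contDiffOn ?_
      have hm : ContDiff ℝ k (fun z : ℝ × ℝ => ((Θ.γ z.2, z.1) : E × ℝ)) :=
        (hΘ.comp contDiff_snd).prodMk contDiff_fst
      intro z hz
      have hz1 : z.1 ∈ Ioo (-r₀) r₀ := (mem_prod.1 hz).1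
      have h1 : ContDiffAt ℝ k σ' (Θ.γ z.2, z.1) := hσ'C _ _ (hγtube z.2) hz1
      exact (h1.comp z hm.contDiffAt).contDiffWithinAt
    have h := hψCk.comp_contDiffOn hinner
    refine h.congr fun z hz => ?_
    simp only [hpdef, hσ', Function.comp_apply]
    rfl
  · -- injectivity on a period
    intro ρ hρ θ₁ hθ₁ θ₂ hθ₂ heq
    rw [hr2] at hρ
    simp only [hpdef] at heq
    set x₁ := Θ.γ θ₁ with hx₁
    set x₂ := Θ.γ θ₂ with hx₂
    obtain ⟨hconf₁, hlev₁⟩ := hσ x₁ ρ (hγtube θ₁) hρ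
    obtain ⟨hconf₂, hlev₂⟩ := hσ x₂ ρ (hγtube θ₂) hρ
    set t₁ := σ x₁ ρ with ht₁
    set t₂ := σ x₂ ρ with ht₂
    -- both starting points lie on one flow line
    have hback : x₂ = ψ x₁ (t₁ - t₂) := by
      rw [sub_eq_add_neg, hψadd, heq, ← hψadd, add_neg_cancel, hψ0]
    have hshift : ∀ r, ψ x₁ r = ψ x₂ (r - t₁ + t₂) := fun r => by
      rw [hback, ← hψadd]; congr 1; ring
    -- the time `t₁ - t₂` is tube-confined for the line through `x₁`
    have hconf : ∀ r ∈ uIcc 0 (t₁ - t₂), |g (x₁, r)| < r₀ := by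
      intro r hr
      rcases uIcc_subset_uIcc_union_uIcc (b := t₁) hr with h1 | h1
      · exact hconf₁ r h1
      · have h2 : r - t₁ + t₂ ∈ uIcc 0 t₂ := by
          rw [mem_uIcc] at h1 ⊢
          rcases h1 with ⟨ha, hb⟩ | ⟨ha, hb⟩
          · right; constructor <;> linarith
          · left; constructor <;> linarith
        have h3 := hconf₂ _ h2
        simpa [hgdef, hshift r] using h3
    have hzero : g (x₁, t₁ - t₂) = g (x₁, 0) := by
      have h1 : e x₂ = 0 := by rw [hx₂]; exact hγ0 θ₂
      have h2 : e x₁ = 0 := by rw [hx₁]; exact hγ0 θ₁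
      simp only [hgdef, ← hback, hψ0, h1, h2]
    have hconf0 : ∀ r ∈ uIcc (0 : ℝ) 0, |g (x₁, r)| < r₀ := fun r hr => by
      rw [uIcc_self, mem_singleton_iff] at hr
      rw [hr]; simpa [hgdef, hψ0] using hγtube θ₁
    have ht : t₁ - t₂ = 0 := huniq x₁ _ _ hconf hconf0 hzero
    have hx : x₁ = x₂ := by rw [hback, ht, hψ0]
    exact Θ.injOn hθ₁ hθ₂ (by rw [← hx₁, ← hx₂]; exact hx)
  · -- the coordinates cover the tube
    intro q hq
    rw [hr2] at hq
    have h0mem : (0 : ℝ) ∈ Ioo (-r₀) r₀ := ⟨by linarith, hr₀⟩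
    obtain ⟨hconf, hlev⟩ := hσ q 0 hq h0mem
    set ts := σ q 0 with hts
    set q' := ψ q ts with hq'
    have hq'S : e q' = 0 := hlev
    obtain ⟨gl, hgl⟩ := (cr.existsUnique_rep q').exists
    have hmemS : q' + (gl : E) ∈ cr.fermiSurfaceRep e := by
      refine ⟨?_, hgl⟩
      show e (q' + (gl : E)) = 0
      rw [hA2.periodic _ gl.2, hq'S]
    obtain ⟨θ, -, hθ⟩ := Θ.surjOn hmemS
    refine ⟨gl, gl.2, θ, ?_⟩
    -- the flow line through `Θ.γ θ = q' + gl` is the translate of the line through `q`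
    have hline_eq : ∀ r, ψ (Θ.γ θ) r = ψ q (ts + r) + (gl : E) := fun r => by
      rw [hθ, hψequiv _ gl.2, hq', ← hψadd]
    have hconfθ : ∀ r ∈ uIcc 0 (-ts), |g (Θ.γ θ, r)| < r₀ := by
      intro r hr
      have h1 : ts + r ∈ uIcc 0 ts := by
        rw [mem_uIcc] at hr ⊢
        rcases hr with ⟨ha, hb⟩ | ⟨ha, hb⟩
        · right; constructor <;> linarith
        · left; constructor <;> linarith
      have h2 := hconf _ h1
      simpa [hgdef, hline_eq r, hA2.periodic _ gl.2] using h2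
    have hval : g (Θ.γ θ, -ts) = e q := by
      simp [hgdef, hline_eq (-ts), hA2.periodic _ gl.2, hψ0]
    have hσval : σ (Θ.γ θ) (e q) = -ts := by
      have h1 := hK1 (Θ.γ θ) (-ts) hconfθ
      rwa [hval] at h1
    show ψ (Θ.γ θ) (σ (Θ.γ θ) (e q)) = q + (gl : E)
    rw [hσval, hline_eq, add_neg_cancel, hψ0]

/-- **[II] §2.2 / [I, Lemma 2.1]: the tubular coordinates exist, with prescribed angular coordinate.**
"For `r₀ > 0` let `𝒜 = (-2r₀, 2r₀) × S`. Then there is an `r₀ > 0` and a `C^k`-diffeomorphism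
`ϕ : 𝒜 → ϕ(𝒜) ⊂ 𝓑`, `(ρ, σ) ↦ p = ϕ(ρ, σ)`, such that `e(ϕ(ρ, σ)) = ρ`, and such that
`|∇e(ϕ(ρ,σ))| ≥ g₀ > 0` for all `|ρ| < r₀` and all `σ`. `ϕ` is constructed explicitly in Lemma 2.1 in
[I], using the integral curves of a `C^∞` vector field `u` that is transversal to `S` in the sense that
`u(p)·∇e(p) ≥ u₀ ≥ g₀/2`" ([II] p.8 L35–50). Under (A2)_{k,h} with `k ≥ 2` and geometric constants
`GeomConstants e K r₀ g₀ wmin` ((gzerinit) on `{|e| < r₀}`), every angular coordinate `Θ` of `S ∩ F`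
with `C^k` curve extends to a coordinate datum `TubularCoords cr e k (r₀/2)` (tube `{|e| < r₀}`) whose
`ρ = 0` slice is `Θ` (the case `r = r₀/2` of `exists_tubularCoords_of_gradient_bound`; with
`GeomConstants.of_radius_le` the pair (`GeomConstants e K (r₀/2) g₀ wmin`, `TubularCoords cr e k (r₀/2)`)
is the one-radius datum of [II] p.8 L36–44). Valid in any dimension.
[cite: FeldmanSalmhoferTrubowitz1998, §2.2 (arXiv p.8 L35-60)] -/
theorem exists_tubularCoords_base_eq (cr : Crystal E) {e : E → ℝ} {k : ℕ} {h : ℝ≥0}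
    {K r₀ g₀ wmin : ℝ} (hk : 2 ≤ k) (hA2 : HypA2 cr k h e) (hgc : GeomConstants e K r₀ g₀ wmin)
    (Θ : FermiCurveParam cr e) (hΘ : ContDiff ℝ k Θ.γ) :
    ∃ Φ : TubularCoords cr e k (r₀ / 2), Φ.base = Θ :=
  exists_tubularCoords_of_gradient_bound cr hk hA2 hgc.norm_iteratedFDeriv_le (half_pos hgc.r₀_pos)
    hgc.g₀_pos (fun p hp => hgc.le_norm_gradient p (by linarith)) Θ hΘ

omit [FiniteDimensional ℝ E] [MeasurableSpace E] [BorelSpace E] in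
/-- The geometric constants of a band ((gzerinit) `|∇e| ≥ g₀` and the curvature bound `w ≥ wmin` on the
tube `{|e| < r₀}`, `|e|₂ ≤ K`; [II] p.8 L38–44, Lemma 2.1) are inherited by every smaller tube radius
`0 < r₁ ≤ r₀` — [II] fixes ONE `r₀` serving both the coordinates on `(-2r₀, 2r₀) × S` and (gzerinit) on
`|ρ| < r₀` (p.8 L36–44); this lemma is the bookkeeping that lets `r₀` be decreased.
[cite: FeldmanSalmhoferTrubowitz1998, §2.2 eq. (gzerinit) (arXiv p.8 L36-44)] -/
theorem GeomConstants.of_radius_le {e : E → ℝ} {K r₀ r₁ g₀ wmin : ℝ}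
    (hgc : GeomConstants e K r₀ g₀ wmin) (hr₁ : 0 < r₁) (hle : r₁ ≤ r₀) :
    GeomConstants e K r₁ g₀ wmin where
  r₀_pos := hr₁
  g₀_pos := hgc.g₀_pos
  wmin_pos := hgc.wmin_pos
  norm_iteratedFDeriv_le := hgc.norm_iteratedFDeriv_le
  le_norm_gradient := fun p hp => hgc.le_norm_gradient p (lt_of_lt_of_le hp hle)
  le_hessQuad := fun p hp t ht => hgc.le_hessQuad p (lt_of_lt_of_le hp hle) t ht

/-- **The coordinate datum of [II] §2.2 is inhabited** for every band with (A2)_{k,h} (`k ≥ 2`), the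
global half of (A3) (`S ∩ F = ∂C`, giving the angular coordinate) and geometric constants
`GeomConstants e K r₀ g₀ wmin`, in `d = 2`: `TubularCoords cr e k (r₀/2)` (tube `{|e| < r₀}`). In
particular the `∀ Φ : TubularCoords …`-binders of the strings theorem (Theorem 3.5,
`FST2SecondOrderStrings.StringsTheorem`) and of its users range over a non-empty type for every
admissible band. [cite: FeldmanSalmhoferTrubowitz1998, §2.2 (arXiv p.8 L35-60)] -/
theorem nonempty_tubularCoords (cr : Crystal E) (hd : Module.finrank ℝ E = 2) {e : E → ℝ} {k : ℕ}
    {h : ℝ≥0} {K r₀ g₀ wmin : ℝ} (hk : 2 ≤ k) (hA2 : HypA2 cr k h e) (hG : HypA3Global cr e)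
    (hgc : GeomConstants e K r₀ g₀ wmin) : Nonempty (TubularCoords cr e k (r₀ / 2)) := by
  obtain ⟨Θ, hΘ, -, -⟩ := exists_fermiCurveParam_contDiff cr hd (one_le_two.trans hk) hA2 hG
  obtain ⟨Φ, -⟩ := exists_tubularCoords_base_eq cr hk hA2 hgc Θ hΘ
  exact ⟨Φ⟩

/-- **The one-radius datum of [II] §2.2** ("there is an `r₀ > 0`" such that BOTH the coordinates exist
on `(-2r₀, 2r₀) × S` AND (gzerinit) holds on `|ρ| < r₀`, p.8 L36–44): under (A2)_{k,h} (`k ≥ 2`),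
`HypA3Global` and `GeomConstants e K r₀ g₀ wmin`, in `d = 2`, the radius `r₀/2` carries geometric
constants and a coordinate datum simultaneously — the joint hypothesis shape
`GeomConstants e K r g₀ wmin ∧ TubularCoords cr e k r` of Theorem 3.5 (`StringsTheorem`) is satisfiable
for every admissible band, with `r = r₀/2`. [cite: FeldmanSalmhoferTrubowitz1998, §2.2 (arXiv p.8 L36-44)] -/
theorem exists_geomConstants_and_tubularCoords (cr : Crystal E) (hd : Module.finrank ℝ E = 2)
    {e : E → ℝ} {k : ℕ} {h : ℝ≥0} {K r₀ g₀ wmin : ℝ} (hk : 2 ≤ k) (hA2 : HypA2 cr k h e)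
    (hG : HypA3Global cr e) (hgc : GeomConstants e K r₀ g₀ wmin) :
    GeomConstants e K (r₀ / 2) g₀ wmin ∧ Nonempty (TubularCoords cr e k (r₀ / 2)) :=
  ⟨hgc.of_radius_le (half_pos hgc.r₀_pos) (half_le_self hgc.r₀_pos.le),
    nonempty_tubularCoords cr hd hk hA2 hG hgc⟩

end Assembly

/-! ### §6 Consequences of the datum: joint injectivity and the identities (Trick) at general `ρ` -/

section Consequences

variable {E : Type*} [NormedAddCommGroup E] [InnerProductSpace ℝ E] [CompleteSpace E]
  {cr : Crystal E} {e : E → ℝ} {k : ℕ} {r₀ : ℝ}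

/-- The coordinates stay in the tube: `|e(p(ρ, θ))| = |ρ| < 2r₀` on the strip ([II] §2.2:
`𝒜 = (-2r₀, 2r₀) × S`, `e(ϕ(ρ,σ)) = ρ`, p.8 L36–39). [cite: FeldmanSalmhoferTrubowitz1998, §2.2 (arXiv p.8 L36-39)] -/
theorem TubularCoords.abs_apply_lt (Φ : TubularCoords cr e k r₀) {ρ : ℝ}
    (hρ : ρ ∈ Ioo (-(2 * r₀)) (2 * r₀)) (θ : ℝ) : |e (Φ.p ρ θ)| < 2 * r₀ := by
  rw [Φ.level θ ρ hρ]
  exact abs_lt.2 ⟨hρ.1, hρ.2⟩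

/-- **The coordinate map is injective on `(-2r₀, 2r₀) × [0, 2π)`** ("`ϕ : 𝒜 → ϕ(𝒜) ⊂ 𝓑` is a
`C^k`-diffeomorphism", [II] p.8 L36–38): `ρ` is recovered as `e(p)` and `θ` by injectivity on the
period. [cite: FeldmanSalmhoferTrubowitz1998, §2.2 (arXiv p.8 L36-38)] -/
theorem TubularCoords.injOn_uncurry (Φ : TubularCoords cr e k r₀) :
    InjOn (Function.uncurry Φ.p) (Ioo (-(2 * r₀)) (2 * r₀) ×ˢ Ico 0 (2 * Real.pi)) := by
  rintro ⟨ρ, θ⟩ ⟨hρ, hθ⟩ ⟨ρ', θ'⟩ ⟨hρ', hθ'⟩ heq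
  simp only [Function.uncurry_apply_pair] at heq
  have hρρ : ρ = ρ' := by
    rw [← Φ.level θ ρ hρ, ← Φ.level θ' ρ' hρ', heq]
  subst hρρ
  have hθθ : θ = θ' := Φ.injOn ρ hρ hθ hθ' heq
  rw [hθθ]

/-- (Trick) at general `ρ`, first identity ([II] p.9 L13–15: "`e(p(ρ,θ)) = ρ` for all `θ`, so
`∇e(p(ρ,θ))·∂_θ p(ρ,θ) = 0`"): along each level line the gradient is orthogonal to every `θ`-velocity.
[cite: FeldmanSalmhoferTrubowitz1998, Lemma 2.1 proof eq. (Trick) (arXiv p.9 L13-15)] -/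
theorem TubularCoords.inner_gradient_dtheta_eq_zero (Φ : TubularCoords cr e k r₀)
    (he : Differentiable ℝ e) {ρ : ℝ} (hρ : ρ ∈ Ioo (-(2 * r₀)) (2 * r₀)) {θ : ℝ} {v : E}
    (hv : HasDerivAt (fun θ' => Φ.p ρ θ') v θ) : inner ℝ (gradient e (Φ.p ρ θ)) v = 0 := by
  have h1 : HasDerivAt (fun θ' => e (Φ.p ρ θ')) (fderiv ℝ e (Φ.p ρ θ) v) θ :=
    (he _).hasFDerivAt.comp_hasDerivAt θ hv
  have h2 : HasDerivAt (fun θ' => e (Φ.p ρ θ')) 0 θ := by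
    have h0 : (fun θ' => e (Φ.p ρ θ')) = fun _ => ρ := funext fun θ' => Φ.level θ' ρ hρ
    rw [h0]
    exact hasDerivAt_const θ ρ
  rw [inner_gradient_left]
  exact h1.unique h2

/-- The transversality constant is non-degenerate along the coordinates: `u(p)·∇e(p) > 0` at every
`p = p(ρ, θ)` of the strip ((uzerinit) p.8 L47–50). [cite: FeldmanSalmhoferTrubowitz1998, §2.2 eq. (uzerinit) (arXiv p.8 L47-50)] -/
theorem TubularCoords.inner_u_gradient_pos (Φ : TubularCoords cr e k r₀) {ρ : ℝ}
    (hρ : ρ ∈ Ioo (-(2 * r₀)) (2 * r₀)) (θ : ℝ) :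
    0 < inner ℝ (Φ.u (Φ.p ρ θ)) (gradient e (Φ.p ρ θ)) := by
  obtain ⟨u₀, hu₀, hu⟩ := Φ.u_transversal
  exact lt_of_lt_of_le hu₀ (hu _ (Φ.abs_apply_lt hρ θ))

/-- (Trick) at general `ρ`, radial identity: `∇e(p)·∂_ρ p = 1` — the radial velocity `∂_ρ p = u/(u·∇e)`
is dual to the gradient (differentiate `e(p(ρ,θ)) = ρ` in `ρ`; [I] (drhdta) `∂ρ/∂τ = (∇e·u)(Ψ)`,
p.14 L17–21). [cite: FeldmanSalmhoferTrubowitz1996, Lemma 2.1 (iv) eq. (drhdta) (arXiv p.14 L17-21)] -/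
theorem TubularCoords.inner_gradient_drho_eq_one (Φ : TubularCoords cr e k r₀) {ρ : ℝ}
    (hρ : ρ ∈ Ioo (-(2 * r₀)) (2 * r₀)) (θ : ℝ) :
    inner ℝ (gradient e (Φ.p ρ θ))
      ((inner ℝ (Φ.u (Φ.p ρ θ)) (gradient e (Φ.p ρ θ)))⁻¹ • Φ.u (Φ.p ρ θ)) = 1 := by
  have hc := (Φ.inner_u_gradient_pos hρ θ).ne'
  rw [real_inner_comm] at hc
  rw [inner_smul_right, real_inner_comm, inv_mul_cancel₀ hc]

/-- The radial and angular velocities are linearly independent wherever the angular velocity is non-zero: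
`∇e·∂_ρ p = 1` and `∇e·∂_θ p = 0` (so the Jacobian (JacobianJ) of [II] p.8 L56–60 does not vanish
there). [cite: FeldmanSalmhoferTrubowitz1998, §2.2 eq. (JacobianJ) (arXiv p.8 L56-60)] -/
theorem TubularCoords.drho_ne_smul_dtheta (Φ : TubularCoords cr e k r₀) (he : Differentiable ℝ e)
    {ρ : ℝ} (hρ : ρ ∈ Ioo (-(2 * r₀)) (2 * r₀)) {θ : ℝ} {v : E}
    (hv : HasDerivAt (fun θ' => Φ.p ρ θ') v θ) (c : ℝ) :
    (inner ℝ (Φ.u (Φ.p ρ θ)) (gradient e (Φ.p ρ θ)))⁻¹ • Φ.u (Φ.p ρ θ) ≠ c • v := by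
  intro h
  have h1 := Φ.inner_gradient_drho_eq_one hρ θ
  rw [h, inner_smul_right, Φ.inner_gradient_dtheta_eq_zero he hρ hv, mul_zero] at h1
  exact zero_ne_one h1

omit [CompleteSpace E] in
/-- A continuous `Γ#`-periodic field on a crystal is bounded (the torus `E/Γ#` is compact:
`IsZLattice.isCompact_range_of_periodic`). [folklore] -/
private theorem exists_norm_le_of_isLatticePeriodic [FiniteDimensional ℝ E] (cr : Crystal E)
    {u : E → E} (hu : Continuous u) (hper : IsLatticePeriodic cr.dualLattice u) :
    ∃ B : ℝ, ∀ q, ‖u q‖ ≤ B := by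
  haveI : DiscreteTopology cr.dualLattice := cr.discrete
  haveI : IsZLattice ℝ cr.dualLattice := ⟨cr.span_eq_top⟩
  have hc := IsZLattice.isCompact_range_of_periodic cr.dualLattice u hu fun z w hw => hper w hw z
  obtain ⟨B, hB⟩ := isBounded_iff_forall_norm_le.1 hc.isBounded
  exact ⟨B, fun q => hB _ (mem_range_self q)⟩

/-- **(Interpol)** ([I] Lemma 2.1 (iii), p.13 L76–84: "`q = π_⊥(q) + ∫₀^{τ(q)} u(γ_{π_⊥(q)}(t)) dt`, so
`|q - π_⊥(q)| ≤ |τ(q)|` and `|q - π_⊥(q)| ≤ |e(q)|/u₀`" — there with `|u| = 1`): along the coordinates the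
distance from the Fermi curve is controlled by the level, `‖p(ρ, θ) - p(0, θ)‖ ≤ A |ρ|` on the strip,
with `A = sup‖u‖/u₀` (`u` is bounded as a continuous periodic field, and `∂_ρ p = u/(u·∇e)` with
`u·∇e ≥ u₀`). [cite: FeldmanSalmhoferTrubowitz1996, Lemma 2.1 (iii) eq. (Interpol) (arXiv p.13 L76-84)] -/
theorem TubularCoords.exists_norm_sub_base_le [FiniteDimensional ℝ E] (Φ : TubularCoords cr e k r₀) :
    ∃ A : ℝ, 0 ≤ A ∧ ∀ θ, ∀ ρ ∈ Ioo (-(2 * r₀)) (2 * r₀), ‖Φ.p ρ θ - Φ.base.γ θ‖ ≤ A * |ρ| := by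
  obtain ⟨B, hB⟩ := exists_norm_le_of_isLatticePeriodic cr Φ.u_contDiff.continuous Φ.u_periodic
  obtain ⟨u₀, hu₀, hu⟩ := Φ.u_transversal
  have hB0 : 0 ≤ B := (norm_nonneg _).trans (hB 0)
  refine ⟨B / u₀, div_nonneg hB0 hu₀.le, fun θ ρ hρ => ?_⟩
  have h0 : (0 : ℝ) ∈ Ioo (-(2 * r₀)) (2 * r₀) := ⟨by linarith [hρ.1, hρ.2], by linarith [hρ.1, hρ.2]⟩
  -- the radial velocity is bounded by `B/u₀` on the strip
  have hder : ∀ ρ' ∈ Ioo (-(2 * r₀)) (2 * r₀), HasDerivWithinAt (fun ρ'' => Φ.p ρ'' θ)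
      ((inner ℝ (Φ.u (Φ.p ρ' θ)) (gradient e (Φ.p ρ' θ)))⁻¹ • Φ.u (Φ.p ρ' θ))
      (Ioo (-(2 * r₀)) (2 * r₀)) ρ' := fun ρ' hρ' => (Φ.hasDerivAt_rho θ ρ' hρ').hasDerivWithinAt
  have hbound : ∀ ρ' ∈ Ioo (-(2 * r₀)) (2 * r₀),
      ‖(inner ℝ (Φ.u (Φ.p ρ' θ)) (gradient e (Φ.p ρ' θ)))⁻¹ • Φ.u (Φ.p ρ' θ)‖ ≤ B / u₀ := by
    intro ρ' hρ'
    have hc : u₀ ≤ inner ℝ (Φ.u (Φ.p ρ' θ)) (gradient e (Φ.p ρ' θ)) := hu _ (Φ.abs_apply_lt hρ' θ)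
    have hcpos : 0 < inner ℝ (Φ.u (Φ.p ρ' θ)) (gradient e (Φ.p ρ' θ)) := lt_of_lt_of_le hu₀ hc
    rw [norm_smul, norm_inv, Real.norm_of_nonneg hcpos.le, inv_mul_eq_div]
    exact div_le_div₀ hB0 (hB _) hu₀ hc
  have h := (convex_Ioo (-(2 * r₀)) (2 * r₀)).norm_image_sub_le_of_norm_hasDerivWithin_le hder hbound
    h0 hρ
  have hp0 : Φ.p 0 θ = Φ.base.γ θ := by rw [Φ.p_zero]
  simpa [hp0] using h

omit [CompleteSpace E] in
/-- A continuous `Γ#`-periodic map on a crystal (any normed codomain) has bounded range — the torus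
`E/Γ#` is compact (`IsZLattice.isCompact_range_of_periodic`). [folklore] -/
private theorem exists_norm_le_of_isLatticePeriodic' [FiniteDimensional ℝ E] (cr : Crystal E)
    {F : Type*} [NormedAddCommGroup F] {f : E → F} (hf : Continuous f)
    (hper : IsLatticePeriodic cr.dualLattice f) : ∃ B : ℝ, ∀ q, ‖f q‖ ≤ B := by
  haveI : DiscreteTopology cr.dualLattice := cr.discrete
  haveI : IsZLattice ℝ cr.dualLattice := ⟨cr.span_eq_top⟩
  have hc := IsZLattice.isCompact_range_of_periodic cr.dualLattice f hf fun z w hw => hper w hw z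
  obtain ⟨B, hB⟩ := isBounded_iff_forall_norm_le.1 hc.isBounded
  exact ⟨B, fun q => hB _ (mem_range_self q)⟩

omit [CompleteSpace E] in
/-- A `C¹` `Γ#`-periodic map on a crystal is globally Lipschitz: its derivative is continuous and
`Γ#`-periodic, hence bounded, and the mean value inequality applies on the (convex) space `E`.
[folklore] -/
private theorem exists_lipschitzWith_of_isLatticePeriodic [FiniteDimensional ℝ E] (cr : Crystal E)
    {F : Type*} [NormedAddCommGroup F] [NormedSpace ℝ F] {f : E → F} (hf : ContDiff ℝ 1 f)
    (hper : IsLatticePeriodic cr.dualLattice f) : ∃ K : ℝ≥0, LipschitzWith K f := by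
  have hper' : IsLatticePeriodic cr.dualLattice (fderiv ℝ f) := by
    intro γ hγ q
    rw [← fderiv_comp_add_right γ]
    congr 1
    ext x
    exact hper γ hγ x
  obtain ⟨B, hB⟩ := exists_norm_le_of_isLatticePeriodic' cr (hf.continuous_fderiv one_ne_zero) hper'
  refine ⟨Real.toNNReal B, lipschitzWith_of_nnnorm_fderiv_le (hf.differentiable one_ne_zero) fun x => ?_⟩
  rw [← NNReal.coe_le_coe, coe_nnnorm]
  exact (hB x).trans (Real.le_coe_toNNReal B)

/-- **Level lines through `Γ#`-translates are `Γ#`-translates** (the content of "`ϕ : 𝒜 → ϕ(𝒜) ⊂ 𝓑`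
is a `C^k`-diffeomorphism" ON THE TORUS `𝓑 = E/Γ#`, [II] p.8 L36–38, with [I] Lemma 2.1 (i): the lines
`ρ ↦ p(ρ, θ)` are the integral curves `γ` of the transversal field): if two level lines of the
coordinates agree up to a dual-lattice vector `g` at one level `ρ₀`, they agree up to `g` at every
level `|ρ| < 2r₀` — both `ρ ↦ p(ρ, θ)` and `ρ ↦ p(ρ, θ') + g` are integral curves of the `Γ#`-periodic
field `u/(u·∇e)` (periodicity of `u` and of `∇e`), which is `C¹` on the tube (`e ∈ C²`,
`u·∇e ≥ u₀ > 0`); we extend it off the tube to a `C¹` periodic, hence globally Lipschitz, field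
(`u/d(u·∇e)` with a smooth `d ≥ u₀/2`, `d(s) = s` for `s ≥ u₀`) and apply uniqueness of solutions
(`ODE_solution_unique_of_mem_Ioo`). [cite: FeldmanSalmhoferTrubowitz1998, §2.2 (arXiv p.8 L36-50)] -/
theorem TubularCoords.apply_eq_add_of_apply_eq_add [FiniteDimensional ℝ E]
    (Φ : TubularCoords cr e k r₀) (he : ContDiff ℝ 2 e) (hper : IsLatticePeriodic cr.dualLattice e)
    {g : E} (hg : g ∈ cr.dualLattice) {θ θ' ρ₀ : ℝ} (hρ₀ : ρ₀ ∈ Ioo (-(2 * r₀)) (2 * r₀))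
    (h₀ : Φ.p ρ₀ θ = Φ.p ρ₀ θ' + g) :
    ∀ ρ ∈ Ioo (-(2 * r₀)) (2 * r₀), Φ.p ρ θ = Φ.p ρ θ' + g := by
  obtain ⟨u₀, hu₀, hu⟩ := Φ.u_transversal
  have hu1 : ContDiff ℝ 1 Φ.u := Φ.u_contDiff.of_le (by exact_mod_cast le_top)
  -- a `C¹` function `d ≥ u₀/2` with `d s = s` for `s ≥ u₀`
  set hcut : ℝ → ℝ := fun s => Real.smoothTransition ((2 * s - u₀) / u₀) with hhcut
  set d : ℝ → ℝ := fun s => hcut s * s + (1 - hcut s) * u₀ with hd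
  have hcut_smooth : ContDiff ℝ 1 hcut :=
    Real.smoothTransition.contDiff.comp
      (((contDiff_const.mul contDiff_id).sub contDiff_const).div_const u₀)
  have hd_smooth : ContDiff ℝ 1 d :=
    (hcut_smooth.mul contDiff_id).add ((contDiff_const.sub hcut_smooth).mul contDiff_const)
  have hd_eq : ∀ s, u₀ ≤ s → d s = s := by
    intro s hs
    have h1 : hcut s = 1 :=
      Real.smoothTransition.one_of_one_le (by rw [le_div_iff₀ hu₀]; linarith)
    simp only [hd, h1]
    ring
  have hd_ge : ∀ s, u₀ / 2 ≤ d s := by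
    intro s
    by_cases hs : s ≤ u₀ / 2
    · have h1 : hcut s = 0 :=
        Real.smoothTransition.zero_of_nonpos (div_nonpos_of_nonpos_of_nonneg (by linarith) hu₀.le)
      simp only [hd, h1]
      linarith
    · rw [not_le] at hs
      have h0 := Real.smoothTransition.nonneg ((2 * s - u₀) / u₀)
      have h1 := Real.smoothTransition.le_one ((2 * s - u₀) / u₀)
      have h2 : u₀ / 2 ≤ hcut s * s + (1 - hcut s) * u₀ := by
        nlinarith [mul_le_mul_of_nonneg_left hs.le h0]
      exact h2
  have hd_ne : ∀ s, d s ≠ 0 := fun s => (lt_of_lt_of_le (half_pos hu₀) (hd_ge s)).ne'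
  -- the pairing `S(q) = De(q)·u(q) = u(q)·∇e(q)`: `C¹` and `Γ#`-periodic
  set S : E → ℝ := fun q => fderiv ℝ e q (Φ.u q) with hS
  have hS_eq : ∀ q, S q = inner ℝ (Φ.u q) (gradient e q) := fun q => by
    simp only [hS]
    rw [← inner_gradient_left, real_inner_comm]
  have hS_smooth : ContDiff ℝ 1 S := (he.fderiv_right (by norm_num)).clm_apply hu1
  have hS_per : IsLatticePeriodic cr.dualLattice S := by
    intro γ hγ q
    simp only [hS]
    rw [Φ.u_periodic γ hγ q, ← fderiv_comp_add_right γ]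
    have hfun : (fun x => e (x + γ)) = e := funext fun x => hper γ hγ x
    rw [hfun]
  -- the extended field `V = u/d(S)`: `C¹`, `Γ#`-periodic, globally Lipschitz, `= u/(u·∇e)` on the tube
  set V : E → E := fun q => (d (S q))⁻¹ • Φ.u q with hV
  have hV_smooth : ContDiff ℝ 1 V :=
    ((hd_smooth.comp hS_smooth).inv fun q => hd_ne _).smul hu1
  have hV_per : IsLatticePeriodic cr.dualLattice V := by
    intro γ hγ q
    simp only [hV]
    rw [hS_per γ hγ q, Φ.u_periodic γ hγ q]
  obtain ⟨K, hK⟩ := exists_lipschitzWith_of_isLatticePeriodic cr hV_smooth hV_per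
  have hV_eq : ∀ q, |e q| < 2 * r₀ → V q = (inner ℝ (Φ.u q) (gradient e q))⁻¹ • Φ.u q := by
    intro q hq
    simp only [hV]
    rw [hd_eq (S q) (by rw [hS_eq]; exact hu q hq), hS_eq]
  -- both curves solve `x' = V(x)` on the strip and agree at `ρ₀`
  have hf : ∀ t ∈ Ioo (-(2 * r₀)) (2 * r₀),
      HasDerivAt (fun t => Φ.p t θ) (V (Φ.p t θ)) t ∧ Φ.p t θ ∈ univ := fun t ht =>
    ⟨by rw [hV_eq _ (Φ.abs_apply_lt ht θ)]; exact Φ.hasDerivAt_rho θ t ht, mem_univ _⟩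
  have hg' : ∀ t ∈ Ioo (-(2 * r₀)) (2 * r₀),
      HasDerivAt (fun t => Φ.p t θ' + g) (V (Φ.p t θ' + g)) t ∧ Φ.p t θ' + g ∈ univ := by
    intro t ht
    refine ⟨?_, mem_univ _⟩
    rw [hV_per g hg, hV_eq _ (Φ.abs_apply_lt ht θ')]
    exact (Φ.hasDerivAt_rho θ' t ht).add_const g
  have huniq := ODE_solution_unique_of_mem_Ioo (v := fun _ => V) (s := fun _ => univ)
    (fun _ _ => hK.lipschitzOnWith) hρ₀ hf hg' h₀
  exact fun ρ hρ => huniq hρ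

/-- **The coordinate map is injective on the torus** ("`ϕ : 𝒜 → ϕ(𝒜) ⊂ 𝓑` is a
`C^k`-diffeomorphism", [II] p.8 L36–38, `𝓑 = E/Γ#`): if `p(ρ, θ)` and `p(ρ', θ')` differ by a
dual-lattice vector, with `|ρ|, |ρ'| < 2r₀` and `θ, θ' ∈ [0, 2π)`, then the vector is `0`, `ρ = ρ'` and
`θ = θ'` — `ρ = e(p) = ρ'` by periodicity of `e`; the two level lines then agree up to `g` at every
level (`apply_eq_add_of_apply_eq_add`), in particular on the Fermi curve, whose parametrisation takes
values in the set of representatives `S ∩ F` (`Crystal.existsUnique_rep` forces `g = 0`); then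
injectivity on the period. [cite: FeldmanSalmhoferTrubowitz1998, §2.2 (arXiv p.8 L36-50)] -/
theorem TubularCoords.eq_of_apply_eq_add [FiniteDimensional ℝ E]
    (Φ : TubularCoords cr e k r₀) (he : ContDiff ℝ 2 e) (hper : IsLatticePeriodic cr.dualLattice e)
    {g : E} (hg : g ∈ cr.dualLattice) {ρ ρ' θ θ' : ℝ} (hρ : ρ ∈ Ioo (-(2 * r₀)) (2 * r₀))
    (hρ' : ρ' ∈ Ioo (-(2 * r₀)) (2 * r₀)) (hθ : θ ∈ Ico 0 (2 * Real.pi))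
    (hθ' : θ' ∈ Ico 0 (2 * Real.pi)) (h : Φ.p ρ θ = Φ.p ρ' θ' + g) :
    g = 0 ∧ ρ = ρ' ∧ θ = θ' := by
  have hρρ : ρ = ρ' := by
    rw [← Φ.level θ ρ hρ, ← Φ.level θ' ρ' hρ', h, hper g hg]
  subst hρρ
  have hzero : (0 : ℝ) ∈ Ioo (-(2 * r₀)) (2 * r₀) :=
    ⟨by linarith [hρ.1, hρ.2], by linarith [hρ.1, hρ.2]⟩
  have hS := Φ.apply_eq_add_of_apply_eq_add he hper hg hρ h 0 hzero
  rw [Φ.p_zero] at hS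
  -- `γ θ, γ θ' ∈ S ∩ F` and `γ θ = γ θ' + g` force `g = 0`
  have hg0 : g = 0 := by
    have hmem : Φ.base.γ θ' + g ∈ cr.fundamentalDomain := by
      rw [← hS]; exact (Φ.base.mem θ).2
    have hmem' : Φ.base.γ θ' + ((0 : cr.dualLattice) : E) ∈ cr.fundamentalDomain := by
      rw [Submodule.coe_zero, add_zero]; exact (Φ.base.mem θ').2
    have huniq := (cr.existsUnique_rep (Φ.base.γ θ')).unique (y₁ := ⟨g, hg⟩) (y₂ := 0) hmem hmem'
    simpa using congrArg Subtype.val huniq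
  subst hg0
  rw [add_zero] at h
  exact ⟨rfl, rfl, Φ.injOn ρ hρ hθ hθ' h⟩

/-- `TubularCoords.eq_of_apply_eq_add` under (A2)_{k,h} with `k ≥ 2` (the hypothesis of [II] §2.2):
the coordinate map of any datum `Φ : TubularCoords cr e k r₀` is injective on the torus.
[cite: FeldmanSalmhoferTrubowitz1998, §2.2 (arXiv p.8 L36-50)] -/
theorem TubularCoords.eq_of_apply_eq_add_of_hypA2 [FiniteDimensional ℝ E] {h : ℝ≥0}
    (Φ : TubularCoords cr e k r₀) (hk : 2 ≤ k) (hA2 : HypA2 cr k h e) {g : E}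
    (hg : g ∈ cr.dualLattice) {ρ ρ' θ θ' : ℝ} (hρ : ρ ∈ Ioo (-(2 * r₀)) (2 * r₀))
    (hρ' : ρ' ∈ Ioo (-(2 * r₀)) (2 * r₀)) (hθ : θ ∈ Ico 0 (2 * Real.pi))
    (hθ' : θ' ∈ Ico 0 (2 * Real.pi)) (hp : Φ.p ρ θ = Φ.p ρ' θ' + g) :
    g = 0 ∧ ρ = ρ' ∧ θ = θ' :=
  Φ.eq_of_apply_eq_add (hA2.memContDiffHolder.1.of_le (by exact_mod_cast hk)) hA2.periodic hg hρ hρ'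
    hθ hθ' hp

end Consequences

/-! ### §7 (JacobianJ): `F` is a fundamental domain, and integration over the tube in the coordinates -/

section ChangeOfVariables

open MeasureTheory
open scoped ENNReal InnerProductSpace Pointwise

variable {E : Type*} [NormedAddCommGroup E] [InnerProductSpace ℝ E] [CompleteSpace E]
  [FiniteDimensional ℝ E] [MeasurableSpace E] [BorelSpace E]
  {cr : Crystal E} {e : E → ℝ} {k : ℕ} {r₀ : ℝ}

omit [CompleteSpace E] [FiniteDimensional ℝ E] [BorelSpace E] in
/-- `F` is a fundamental domain for the translation action of `Γ#` ([II] §2.1 p.6 L108–118: "`𝓑 = ℝ^d/Γ#`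
… `F ⊂ E` a fundamental domain"), in the measure-theoretic sense (`MeasureTheory.IsAddFundamentalDomain`)
as soon as it is measurable: every point has exactly one `Γ#`-translate in `F`
(`Crystal.existsUnique_rep`). [cite: FeldmanSalmhoferTrubowitz1998, §2.1 (arXiv p.6 L108-118)] -/
theorem Crystal.isAddFundamentalDomain_of_measurableSet (cr : Crystal E)
    (hF : MeasurableSet cr.fundamentalDomain) (μ : Measure E) :
    IsAddFundamentalDomain cr.dualLattice cr.fundamentalDomain μ := by
  refine IsAddFundamentalDomain.mk' hF.nullMeasurableSet fun x => ?_
  have h := cr.existsUnique_rep x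
  refine ⟨h.exists.choose, ?_, fun g hg => h.unique ?_ h.exists.choose_spec⟩
  · show h.exists.choose +ᵥ x ∈ cr.fundamentalDomain
    rw [Submodule.vadd_def, vadd_eq_add, add_comm]
    exact h.exists.choose_spec
  · have hg' : g +ᵥ x ∈ cr.fundamentalDomain := hg
    rwa [Submodule.vadd_def, vadd_eq_add, add_comm] at hg'

/-- **(JacobianJ): integration over the tube in the coordinates `(ρ, θ)`** ([II] §2.2 p.8 L56–60: for
functions `F` on the tube, "`∫ d²p F(p) = ∫ dρ ∫ dθ J(ρ, θ) F(p(ρ, θ))`" with "the Jacobian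
`J(ρ, θ) = |det p'(ρ, θ)|`"). For a `C²`, `Γ#`-periodic band, a coordinate datum
`Φ : TubularCoords cr e k r₀` (`k ≥ 1`), a measurable fundamental domain `F`, an orthonormal frame
`b` of `E ≅ ℝ²` (indexed by `Fin 2`, so `d = 2`) — in which `J = |det p'|` is read as
`J(y) = |det(Dp(y) ∘ π_b)|`,
`π_b(x) = (⟪b₀, x⟫, ⟪b₁, x⟫)` — every `0 < ε ≤ 2r₀` and every `Γ#`-periodic `G : E → [0, ∞]`:
`∫_{q ∈ F : |e(q)| < ε} G(q) dq = ∫_{(-ε, ε) × [0, 2π)} J(ρ, θ) G(p(ρ, θ)) dρ dθ`. Proof: `F` is a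
fundamental domain and `G` is periodic, so the left side is the integral over ANY measurable set of
representatives of the tube `{|e| < ε} ⊂ 𝓑`; `p((-ε, ε) × [0, 2π))` is one (the coordinates cover the
tube, `TubularCoords.covers`, and are injective on the torus, `TubularCoords.eq_of_apply_eq_add`);
then the area formula (`MeasureTheory.lintegral_image_eq_lintegral_abs_det_fderiv_mul`, injectivity
`TubularCoords.injOn_uncurry`) and the measure-preserving frame `π_b`.
[cite: FeldmanSalmhoferTrubowitz1998, §2.2 eq. (JacobianJ) (arXiv p.8 L56-60)] -/
theorem TubularCoords.setLIntegral_tube_eq (Φ : TubularCoords cr e k r₀)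
    (hk : 1 ≤ k) (he : ContDiff ℝ 2 e)
    (hper : IsLatticePeriodic cr.dualLattice e) (hF : MeasurableSet cr.fundamentalDomain)
    (b : OrthonormalBasis (Fin 2) ℝ E) {ε : ℝ} (hε2 : ε ≤ 2 * r₀) (G : E → ℝ≥0∞)
    (hG : ∀ γ ∈ cr.dualLattice, ∀ q, G (q + γ) = G q) :
    ∫⁻ q in {q ∈ cr.fundamentalDomain | |e q| < ε}, G q =
      ∫⁻ y in Ioo (-ε) ε ×ˢ Ico 0 (2 * Real.pi),
        ENNReal.ofReal |((fderiv ℝ (Function.uncurry Φ.p) y).comp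
            ((innerSL ℝ (b 0)).prod (innerSL ℝ (b 1)))).det| * G (Φ.p y.1 y.2) := by
  classical
  haveI : DiscreteTopology cr.dualLattice := cr.discrete
  haveI : IsZLattice ℝ cr.dualLattice := ⟨cr.span_eq_top⟩
  have hr₀ := Φ.r₀_pos
  -- the frame map `π` and its measure-theoretic avatar `πe`
  set π : E →L[ℝ] ℝ × ℝ := (innerSL ℝ (b 0)).prod (innerSL ℝ (b 1)) with hπ
  have hπ_apply : ∀ x, π x = (⟪b 0, x⟫_ℝ, ⟪b 1, x⟫_ℝ) := fun x => rfl
  set πe : E ≃ᵐ ℝ × ℝ := b.measurableEquiv.trans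
    ((MeasurableEquiv.toLp 2 (Fin 2 → ℝ)).symm.trans MeasurableEquiv.finTwoArrow) with hπe
  have hπe_eq : (πe : E → ℝ × ℝ) = π := by
    funext x
    rw [hπ_apply]
    simp only [hπe, MeasurableEquiv.trans_apply, MeasurableEquiv.toLp_symm_apply,
      MeasurableEquiv.finTwoArrow_apply, OrthonormalBasis.measurableEquiv,
      Homeomorph.toMeasurableEquiv_coe, LinearIsometryEquiv.coe_toHomeomorph,
      ← OrthonormalBasis.repr_apply_apply]
  have hπmp : MeasurePreserving π volume volume := by
    rw [← hπe_eq]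
    exact b.measurePreserving_measurableEquiv.trans
      ((EuclideanSpace.volume_preserving_symm_measurableEquiv_toLp (Fin 2)).trans
        (volume_preserving_finTwoArrow ℝ))
  have hπemb : MeasurableEmbedding π := by rw [← hπe_eq]; exact πe.measurableEmbedding
  have hπinj : Function.Injective π := hπemb.injective
  -- the parameter set, read in `E`, and the coordinate map on `E`
  set R : Set (ℝ × ℝ) := Ioo (-ε) ε ×ˢ Ico 0 (2 * Real.pi) with hR
  have hRmeas : MeasurableSet R := measurableSet_Ioo.prod measurableSet_Ico
  have hRsub : R ⊆ Ioo (-(2 * r₀)) (2 * r₀) ×ˢ Ico 0 (2 * Real.pi) := fun y hy =>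
    ⟨⟨by linarith [hy.1.1], by linarith [hy.1.2]⟩, hy.2⟩
  set S : Set E := π ⁻¹' R with hS
  have hSmeas : MeasurableSet S := hRmeas.preimage π.continuous.measurable
  set f : E → E := fun x => Function.uncurry Φ.p (π x) with hf
  set f' : E → E →L[ℝ] E := fun x => (fderiv ℝ (Function.uncurry Φ.p) (π x)).comp π with hf'
  -- differentiability on `S`
  set U₀ : Set (ℝ × ℝ) := Ioo (-(2 * r₀)) (2 * r₀) ×ˢ univ with hU₀
  have hU₀open : IsOpen U₀ := isOpen_Ioo.prod isOpen_univ
  have hk1 : (1 : WithTop ℕ∞) ≤ k := by exact_mod_cast hk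
  have hk0 : (k : WithTop ℕ∞) ≠ 0 := ne_of_gt (lt_of_lt_of_le zero_lt_one hk1)
  have hdiff : ∀ y ∈ U₀, HasFDerivAt (Function.uncurry Φ.p) (fderiv ℝ (Function.uncurry Φ.p) y) y :=
    fun y hy => ((Φ.contDiffOn.differentiableOn hk0).differentiableAt (hU₀open.mem_nhds hy)).hasFDerivAt
  have hSU : ∀ x ∈ S, π x ∈ U₀ := fun x hx => ⟨(hRsub hx).1, mem_univ _⟩
  have hfd : ∀ x ∈ S, HasFDerivWithinAt f (f' x) S x :=
    fun x hx => ((hdiff _ (hSU x hx)).comp x π.hasFDerivAt).hasFDerivWithinAt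
  -- injectivity on `S` (injectivity of the coordinates in `E`)
  have hinj : InjOn f S := fun x hx x' hx' hfx =>
    hπinj (Φ.injOn_uncurry (hRsub hx) (hRsub hx') hfx)
  -- the image is measurable; the area formula and the frame
  have hAm : MeasurableSet (f '' S) := measurable_image_of_fderivWithin hSmeas hfd hinj
  have hA : ∫⁻ q in f '' S, G q = ∫⁻ y in R, ENNReal.ofReal
      |((fderiv ℝ (Function.uncurry Φ.p) y).comp π).det| * G (Φ.p y.1 y.2) := by
    rw [lintegral_image_eq_lintegral_abs_det_fderiv_mul volume hSmeas hfd hinj G]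
    exact hπmp.setLIntegral_comp_preimage_emb hπemb
      (fun y => ENNReal.ofReal |((fderiv ℝ (Function.uncurry Φ.p) y).comp π).det| *
        G (Function.uncurry Φ.p y)) R
  -- `F` is a fundamental domain; the translates of the image tile the tube of `𝓑` exactly once
  have hFD := cr.isAddFundamentalDomain_of_measurableSet hF (volume : Measure E)
  haveI : MeasurableVAdd cr.dualLattice E :=
    (inferInstance : MeasurableVAdd cr.dualLattice.toAddSubgroup E)
  haveI : VAddInvariantMeasure cr.dualLattice E (volume : Measure E) :=
    (inferInstance : VAddInvariantMeasure cr.dualLattice.toAddSubgroup E volume)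
  have hGinv : ∀ g : cr.dualLattice, ∀ q, G ((-g) +ᵥ q) = G q := by
    intro g q
    rw [Submodule.vadd_def, vadd_eq_add, add_comm]
    exact hG _ (-g).2 q
  have hDmeas : ∀ g : cr.dualLattice, MeasurableSet ((g +ᵥ f '' S) ∩ cr.fundamentalDomain) :=
    fun g => (hAm.const_vadd g).inter hF
  have hdisj : Pairwise (Disjoint on fun g : cr.dualLattice => (g +ᵥ f '' S) ∩ cr.fundamentalDomain) := by
    intro g g' hne
    refine disjoint_left.2 fun q hq hq' => hne ?_
    obtain ⟨y, ⟨x, hx, rfl⟩, hyq⟩ := Set.mem_vadd_set.1 hq.1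
    obtain ⟨y', ⟨x', hx', rfl⟩, hy'q⟩ := Set.mem_vadd_set.1 hq'.1
    rw [Submodule.vadd_def, vadd_eq_add] at hyq hy'q
    have hfx : Φ.p (π x).1 (π x).2 = Φ.p (π x').1 (π x').2 + ((g' : E) - g) := by
      have h1 : f x = f x' + ((g' : E) - g) := by
        rw [← sub_eq_zero]
        have : (g : E) + f x - ((g' : E) + f x') = 0 := by rw [hyq, hy'q, sub_self]
        rw [← this]
        abel
      simpa only [hf, Function.uncurry] using h1
    have key := Φ.eq_of_apply_eq_add he hper (sub_mem g'.2 g.2) (hRsub hx).1 (hRsub hx').1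
      (hRsub hx).2 (hRsub hx').2 hfx
    exact (Subtype.ext (sub_eq_zero.1 key.1)).symm
  have hcov : (⋃ g : cr.dualLattice, (g +ᵥ f '' S) ∩ cr.fundamentalDomain) =
      {q ∈ cr.fundamentalDomain | |e q| < ε} := by
    ext q
    constructor
    · intro hq
      obtain ⟨g, hq⟩ := mem_iUnion.1 hq
      obtain ⟨y, ⟨x, hx, rfl⟩, hyq⟩ := Set.mem_vadd_set.1 hq.1
      refine ⟨hq.2, ?_⟩
      rw [← hyq, Submodule.vadd_def, vadd_eq_add, add_comm, hper _ g.2]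
      simp only [hf, Function.uncurry]
      rw [Φ.level _ _ (hRsub hx).1]
      exact abs_lt.2 ⟨hx.1.1, hx.1.2⟩
    · rintro ⟨hqF, hqe⟩
      have hq2 : |e q| < 2 * r₀ := lt_of_lt_of_le hqe hε2
      obtain ⟨γ, hγ, θ, hθ⟩ := Φ.covers q hq2
      set θ' : ℝ := toIcoMod Real.two_pi_pos 0 θ with hθ'
      have hθ'mem : θ' ∈ Ico 0 (2 * Real.pi) := toIcoMod_mem_Ico' Real.two_pi_pos θ
      have hpθ' : Φ.p (e q) θ' = Φ.p (e q) θ := by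
        rw [hθ', ← self_sub_toIcoDiv_zsmul]
        exact (Φ.periodic (e q)).sub_zsmul_eq _
      set x : E := (e q) • b 0 + θ' • b 1 with hx
      have hbb := orthonormal_iff_ite.1 b.orthonormal
      have hπx : π x = (e q, θ') := by
        rw [hπ_apply, hx]
        simp only [inner_add_right, inner_smul_right, hbb]
        simp
      refine mem_iUnion.2 ⟨-⟨γ, hγ⟩, ⟨?_, hqF⟩⟩
      refine Set.mem_vadd_set.2 ⟨f x, ⟨x, ?_, rfl⟩, ?_⟩
      · show π x ∈ R
        rw [hπx]
        exact ⟨abs_lt.1 hqe, hθ'mem⟩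
      · rw [Submodule.vadd_def, vadd_eq_add, hf]
        simp only [Function.uncurry, hπx, hpθ', hθ]
        simp
  -- assemble
  calc ∫⁻ q in {q ∈ cr.fundamentalDomain | |e q| < ε}, G q
      = ∫⁻ q in ⋃ g : cr.dualLattice, (g +ᵥ f '' S) ∩ cr.fundamentalDomain, G q := by rw [hcov]
    _ = ∑' g : cr.dualLattice, ∫⁻ q in (g +ᵥ f '' S) ∩ cr.fundamentalDomain, G q :=
        lintegral_iUnion hDmeas hdisj G
    _ = ∑' g : cr.dualLattice, ∫⁻ q in (g +ᵥ f '' S) ∩ cr.fundamentalDomain, G ((-g) +ᵥ q) := by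
        simp_rw [hGinv]
    _ = ∫⁻ q in f '' S, G q := (hFD.setLIntegral_eq_tsum' G (f '' S)).symm
    _ = _ := hA

/-- `TubularCoords.setLIntegral_tube_eq` under (A2)_{k,h} with `k ≥ 2` (the hypothesis of [II] §2.2).
[cite: FeldmanSalmhoferTrubowitz1998, §2.2 eq. (JacobianJ) (arXiv p.8 L56-60)] -/
theorem TubularCoords.setLIntegral_tube_eq_of_hypA2 {h : ℝ≥0} (Φ : TubularCoords cr e k r₀)
    (hk : 2 ≤ k) (hA2 : HypA2 cr k h e) (hF : MeasurableSet cr.fundamentalDomain)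
    (b : OrthonormalBasis (Fin 2) ℝ E) {ε : ℝ} (hε2 : ε ≤ 2 * r₀) (G : E → ℝ≥0∞)
    (hG : ∀ γ ∈ cr.dualLattice, ∀ q, G (q + γ) = G q) :
    ∫⁻ q in {q ∈ cr.fundamentalDomain | |e q| < ε}, G q =
      ∫⁻ y in Ioo (-ε) ε ×ˢ Ico 0 (2 * Real.pi),
        ENNReal.ofReal |((fderiv ℝ (Function.uncurry Φ.p) y).comp
            ((innerSL ℝ (b 0)).prod (innerSL ℝ (b 1)))).det| * G (Φ.p y.1 y.2) :=
  Φ.setLIntegral_tube_eq (le_trans one_le_two hk) (hA2.memContDiffHolder.1.of_le (by exact_mod_cast hk))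
    hA2.periodic hF b hε2 G hG

/-- **Integration over the half-tube is bounded by the parameter integral** ([I] Lemma 2.1 (iv):
"there are constants `A₀` and `A₁` such that the Jacobian `J(ρ, ω) = det p'(ρ, ω)` obeys
`sup_{p ∈ U_δ(S)} |J(ρ, ω)| ≤ A₀/u₀`", p.13 L91–105 — the form in which the coordinates enter every
volume estimate of [II] §3). In `d = 2`: there is `J₀ ≥ 0`, depending on the datum `Φ` only, such that
for every `ε ≤ r₀` and every `Γ#`-periodic `G : E → [0, ∞]`,
`∫_{q ∈ F : |e(q)| < ε} G ≤ J₀ ∫_{(-ε, ε) × [0, 2π)} G(p(ρ, θ)) dρ dθ` — (JacobianJ)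
(`setLIntegral_tube_eq`) with `sup|J| < ∞` on `[-r₀, r₀] × [0, 2π]` by continuity of `Dp` (the printed
value `A₀/u₀` of the constant is not asserted). [cite: FeldmanSalmhoferTrubowitz1996, Lemma 2.1 (iv) (arXiv p.13 L91-105)] -/
theorem TubularCoords.exists_setLIntegral_tube_le (Φ : TubularCoords cr e k r₀)
    (hd : Module.finrank ℝ E = 2) (hk : 1 ≤ k) (he : ContDiff ℝ 2 e)
    (hper : IsLatticePeriodic cr.dualLattice e) (hF : MeasurableSet cr.fundamentalDomain) :
    ∃ J₀ : ℝ, 0 ≤ J₀ ∧ ∀ ε ≤ r₀, ∀ G : E → ℝ≥0∞, (∀ γ ∈ cr.dualLattice, ∀ q, G (q + γ) = G q) →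
      ∫⁻ q in {q ∈ cr.fundamentalDomain | |e q| < ε}, G q ≤
        ENNReal.ofReal J₀ * ∫⁻ y in Ioo (-ε) ε ×ˢ Ico 0 (2 * Real.pi), G (Φ.p y.1 y.2) := by
  have hr₀ := Φ.r₀_pos
  set b : OrthonormalBasis (Fin 2) ℝ E := (stdOrthonormalBasis ℝ E).reindex (finCongr hd) with hb
  set π : E →L[ℝ] ℝ × ℝ := (innerSL ℝ (b 0)).prod (innerSL ℝ (b 1)) with hπ
  -- the Jacobian is continuous on the open strip, hence bounded on `[-r₀, r₀] × [0, 2π]`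
  set U₀ : Set (ℝ × ℝ) := Ioo (-(2 * r₀)) (2 * r₀) ×ˢ univ with hU₀
  have hU₀open : IsOpen U₀ := isOpen_Ioo.prod isOpen_univ
  have hk1 : (1 : WithTop ℕ∞) ≤ k := by exact_mod_cast hk
  have hKU : Icc (-r₀) r₀ ×ˢ Icc 0 (2 * Real.pi) ⊆ U₀ := fun y hy =>
    ⟨⟨by linarith [hy.1.1], by linarith [hy.1.2]⟩, mem_univ _⟩
  have hcont : ContinuousOn (fun y : ℝ × ℝ => ((fderiv ℝ (Function.uncurry Φ.p) y).comp π).det)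
      (Icc (-r₀) r₀ ×ˢ Icc 0 (2 * Real.pi)) := by
    have h1 : ContinuousOn (fderiv ℝ (Function.uncurry Φ.p)) U₀ :=
      Φ.contDiffOn.continuousOn_fderiv_of_isOpen hU₀open hk1
    exact ContinuousLinearMap.continuous_det.comp_continuousOn
      ((h1.mono hKU).clm_comp continuousOn_const)
  obtain ⟨J₀, hJ⟩ := (isCompact_Icc.prod isCompact_Icc).exists_bound_of_continuousOn hcont
  have hJ0 : 0 ≤ J₀ := le_trans (norm_nonneg _) (hJ (0, 0) ⟨⟨by linarith, by linarith⟩,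
    ⟨le_rfl, by positivity⟩⟩)
  refine ⟨J₀, hJ0, fun ε hε G hG => ?_⟩
  rw [Φ.setLIntegral_tube_eq hk he hper hF b (by linarith) G hG]
  have hRmeas : MeasurableSet (Ioo (-ε) ε ×ˢ Ico 0 (2 * Real.pi)) :=
    measurableSet_Ioo.prod measurableSet_Ico
  calc ∫⁻ y in Ioo (-ε) ε ×ˢ Ico 0 (2 * Real.pi), ENNReal.ofReal
        |((fderiv ℝ (Function.uncurry Φ.p) y).comp
            ((innerSL ℝ (b 0)).prod (innerSL ℝ (b 1)))).det| * G (Φ.p y.1 y.2)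
      ≤ ∫⁻ y in Ioo (-ε) ε ×ˢ Ico 0 (2 * Real.pi), ENNReal.ofReal J₀ * G (Φ.p y.1 y.2) := by
        refine setLIntegral_mono' hRmeas fun y hy => ?_
        gcongr
        simpa only [Real.norm_eq_abs] using
          hJ y ⟨⟨by linarith [hy.1.1], by linarith [hy.1.2]⟩, ⟨hy.2.1, hy.2.2.le⟩⟩
    _ = ENNReal.ofReal J₀ * ∫⁻ y in Ioo (-ε) ε ×ˢ Ico 0 (2 * Real.pi), G (Φ.p y.1 y.2) :=
        lintegral_const_mul' _ _ ENNReal.ofReal_ne_top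

/-- `TubularCoords.exists_setLIntegral_tube_le` under (A2)_{k,h} with `k ≥ 2` (the hypothesis of [II] §2.2).
[cite: FeldmanSalmhoferTrubowitz1996, Lemma 2.1 (iv) (arXiv p.13 L91-105)] -/
theorem TubularCoords.exists_setLIntegral_tube_le_of_hypA2 {h : ℝ≥0} (Φ : TubularCoords cr e k r₀)
    (hd : Module.finrank ℝ E = 2) (hk : 2 ≤ k) (hA2 : HypA2 cr k h e)
    (hF : MeasurableSet cr.fundamentalDomain) :
    ∃ J₀ : ℝ, 0 ≤ J₀ ∧ ∀ ε ≤ r₀, ∀ G : E → ℝ≥0∞, (∀ γ ∈ cr.dualLattice, ∀ q, G (q + γ) = G q) →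
      ∫⁻ q in {q ∈ cr.fundamentalDomain | |e q| < ε}, G q ≤
        ENNReal.ofReal J₀ * ∫⁻ y in Ioo (-ε) ε ×ˢ Ico 0 (2 * Real.pi), G (Φ.p y.1 y.2) :=
  Φ.exists_setLIntegral_tube_le hd (le_trans one_le_two hk)
    (hA2.memContDiffHolder.1.of_le (by exact_mod_cast hk)) hA2.periodic hF

end ChangeOfVariables

end Literature.MathematicalPhysics.QuantumLattice.FermiRG

end
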